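import Literature.NumberTheory.Sieve.BombieriAsymptoticSieveSigma0
import HarnessLib

/-!
# Bombieri's asymptotic sieve, rank-uniform form: the smooth-part sums `∑ Λ_j(d) g♯(d)`, uniformly in `j`

Topic `Literature/NumberTheory/Sieve`, companion ("Proofs") file of `BombieriAsymptoticSieve.lean`,
`BombieriAsymptoticSieveSigma0.lean` and `BombieriAsymptoticSieveRankUniform.lean`. Source:
J. Friedlander, H. Iwaniec, *On Bombieri's asymptotic sieve*, Ann. Scuola Norm. Sup. Pisa Cl. Sci.
(4) **5** (1978) 719–756 [FriedlanderIwaniecPisa1978], §5, Lemmata 13–15 (pp. 740–743): the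
estimates `∑_{n ≤ x} Λ_k(n)/f(n) ≤ (log x)^k + c k (log cx)^{k−1}` (`k < ¼ η log x`, Lemma 13) and
their squarefree / rank-vector variants, UNIFORM in `k`, which feed the `k`-uniform bound for
`Σ₀` (Lemma 24) in the proof of their Theorem 2. Everything here is PROVED (theorems only).

## What is here

For a sifted sequence with Bombieri's (A₁), (A₅) and `g ≥ 0`, and the corrected density
`g♯(d) = g(d) ∏_{p ∣ d} (1 − g(p))⁻¹` of `BombieriAsymptoticSieveSigma0.lean` (`SigmaZero.gsharp`),
the sums `G_j(y) = ∑_{d ≤ y} Λ_j(d) g♯(d)` (`SigmaZero.lamG`) and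
`G_j(y; z) = ∑_{1 < d ≤ y, minFac d < z} Λ_j(d) g♯(d)` (`SigmaZero.lamGz`) satisfy, for
`1 ≤ j ≤ c log y`,
`G_j(y) ≤ C (log y + C)^j` and `G_j(y; z) ≤ C j (log y + C)^{j−1} (log z + C)`
with `C, c > 0` depending on the sequence only (`lamG_le_uniform`, `lamGz_le_uniform`). The tree's
`SigmaZero.lamG_le`, `SigmaZero.lamGz_le` give the same shape for each FIXED `j` with constants
growing factorially in `j` (they peel off the least prime power and lose the ordering of the
prime factors); that is enough for [FriedlanderIwaniecPisa1978] Theorem 1 but not for Theorem 2.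

## Proof (a variant of the proof of [FriedlanderIwaniecPisa1978] Lemmata 2 and 13)

Induction on `j` through the recursion `Λ_{j+1} = Λ_j · log + Λ ⋆ Λ_j`
(`generalizedVonMangoldt_succ_apply`), which keeps the bookkeeping exact:
`G_{j+1}(y) = ∑_{m ≤ y} Λ_j(m) g♯(m) log m + ∑_{dm ≤ y} Λ(d) Λ_j(m) g♯(dm)`.
* For `(d, m) = 1`, `g♯(dm) = g♯(d) g♯(m)` and the Mertens-type bound WITH CONSTANT ONE
  `∑_{d ≤ t} Λ(d) g♯(d) ≤ log t + C₀` (`sum_vonMangoldt_mul_gsharp_le`: `g(p) = 1/p + b(p)` with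
  `∑_p |b(p)| p^η < ∞`, [FriedlanderIwaniecPisa1978] Lemma 6, here `summable_abs_density_sub_inv`;
  Mertens' `∑_{p ≤ t} log p/p ≤ log t + log 4`; higher prime powers are `O(1)` by (A₁)) give
  `log m + log (y/m) + C₀ = log y + C₀` — no loss, exactly as in the proof of Lemma 2 (p. 726).
* For `(d, m) > 1`, `d = p^a` with `p ∣ m`; writing `m = p^b m'`, `p ∤ m'`, the rule for `Λ_j` at
  coprime arguments (`generalizedVonMangoldt_mul_of_coprime'`) and `Λ_i(p^b) ≤ (log p^b)^i ≤
  8^i i! (p^b)^{1/8}` (FI, p. 741: "since `e^u > u^j/j!`") bound these terms by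
  `∑_{1 ≤ i ≤ j} (j choose i) K 8^i i! G_{j−i}(y)`, `K = K(𝒜)` (`sum_noncoprime_le`), which is
  `≤ 16 K j G_j-size / log y` once `16 j ≤ log y` — the printed restriction `k < ¼ η log x`.
* The `z`-restricted sums `G_j(y; z)` obey the same recursion with the extra term
  `(log z + C₀) G_j(y)` from the pairs `d = p^a`, `p < z` (`lamGz_succ_le`), whence the factor
  `j (log z + C)` in place of `log y + C`.

No new definitions; no named facts.
-/

noncomputable section

open Filter Finset
open scoped Topology ArithmeticFunction.Moebius ArithmeticFunction.vonMangoldt Nat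

namespace Literature.NumberTheory.Sieve

namespace BombieriSieve

namespace SigmaZero

/-! ### Mertens for `g♯` at primes and prime powers, with constant one -/

/-- **Mertens for `g♯` at the primes, constant one**: under (A₁), (A₅), `g ≥ 0`,
`∑_{p < z} log p · g♯(p) ≤ log z + C` for all `z ≥ 2`. Indeed
`g♯(p) = g(p)/(1 − g(p)) = g(p) + g(p)²/(1 − g(p)) ≤ 1/p + |g(p) − 1/p| + c₀⁻¹ C₁² p^{−7/4}`
(`exists_one_sub_density_ge`, `abs_density_le_rpow78`), `∑_{p ≤ z} log p/p ≤ log z + log 4`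
(Mertens), `∑_p |g(p) − 1/p| log p ≤ η⁻¹ ∑_p |g(p) − 1/p| p^η < ∞` ([FriedlanderIwaniecPisa1978]
Lemma 6, `summable_abs_density_sub_inv`), `log p ≤ 8 p^{1/8}`, `∑_n n^{−13/8} < ∞`.
[cite: FriedlanderIwaniecPisa1978, Lemma 13 (proof, pp. 740-741)] -/
theorem sum_primesBelow_log_mul_gsharp_le (A : SieveSequence) (h1 : A.BombieriA1)
    (h5 : A.BombieriA5) (hg0 : ∀ d : ℕ, 1 ≤ d → 0 ≤ A.density d) :
    ∃ C : ℝ, 0 ≤ C ∧ ∀ z : ℝ, 2 ≤ z →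
      ∑ p ∈ Nat.primesBelow ⌈z⌉₊, Real.log p * gsharp A p ≤ Real.log z + C := by
  obtain ⟨c₀, hc₀, -, hgap⟩ := exists_one_sub_density_ge A h1
  obtain ⟨C₁, hC₁0, hC₁⟩ := abs_density_le_rpow78 A h1
  obtain ⟨η, hη, hsum⟩ := summable_abs_density_sub_inv A h1 h5
  set T : ℝ := ∑' n : ℕ, (if n.Prime then |A.density n - (n : ℝ)⁻¹| * (n : ℝ) ^ η else 0) with hT
  have hT0 : 0 ≤ T := tsum_nonneg fun n => by split_ifs <;> positivity
  have hZs : Summable (fun n : ℕ => ((n : ℝ) ^ (13 / 8 : ℝ))⁻¹) :=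
    Real.summable_nat_rpow_inv.mpr (by norm_num)
  set Z : ℝ := ∑' n : ℕ, ((n : ℝ) ^ (13 / 8 : ℝ))⁻¹ with hZ
  have hZ0 : 0 ≤ Z := tsum_nonneg fun n => by positivity
  refine ⟨Real.log 4 + T / η + c₀⁻¹ * C₁ ^ 2 * 8 * Z, by positivity, fun z hz => ?_⟩
  have hz0 : 0 < z := by linarith
  -- pointwise bound at a prime `p`
  have hpt : ∀ p ∈ Nat.primesBelow ⌈z⌉₊, Real.log p * gsharp A p ≤
      Real.log p / p + η⁻¹ * (if p.Prime then |A.density p - (p : ℝ)⁻¹| * (p : ℝ) ^ η else 0) +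
        c₀⁻¹ * C₁ ^ 2 * 8 * ((p : ℝ) ^ (13 / 8 : ℝ))⁻¹ := by
    intro p hp
    have hpp : p.Prime := Nat.prime_of_mem_primesBelow hp
    have hp0 : (0 : ℝ) < p := by exact_mod_cast hpp.pos
    have hp1 : (1 : ℝ) ≤ p := by exact_mod_cast hpp.one_lt.le
    rw [if_pos hpp]
    set u := A.density p with hu
    have hu0 : 0 ≤ u := hg0 p hpp.one_lt.le
    have hu1 : c₀ ≤ 1 - u := hgap p hpp
    have h1u : 0 < 1 - u := lt_of_lt_of_le hc₀ hu1
    have hlogp : 0 ≤ Real.log p := Real.log_nonneg hp1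
    -- `g♯(p) = u/(1-u) = u + u²/(1-u) ≤ u + u²/c₀`
    have hgs : gsharp A p = u / (1 - u) := by
      rw [← pow_one p, gsharp_prime_pow hpp one_ne_zero, pow_one]
    have hgs_le : gsharp A p ≤ u + c₀⁻¹ * u ^ 2 := by
      rw [hgs, div_le_iff₀ h1u]
      have h2 : u ^ 2 ≤ c₀⁻¹ * u ^ 2 * (1 - u) := by
        calc u ^ 2 = c₀⁻¹ * u ^ 2 * c₀ := by field_simp
          _ ≤ c₀⁻¹ * u ^ 2 * (1 - u) := mul_le_mul_of_nonneg_left hu1 (by positivity)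
      nlinarith
    -- `u ≤ 1/p + |u - 1/p|` and `u² ≤ C₁² p^{-7/4}`
    have habs : u ≤ (p : ℝ)⁻¹ + |u - (p : ℝ)⁻¹| := by
      have := le_abs_self (u - (p : ℝ)⁻¹); linarith
    have hu78 : u ≤ C₁ * (p : ℝ) ^ (-(7 / 8) : ℝ) := (le_abs_self u).trans (hC₁ p hpp.one_lt.le)
    have husq : u ^ 2 ≤ C₁ ^ 2 * (p : ℝ) ^ (-(7 / 4) : ℝ) := by
      have h := mul_le_mul hu78 hu78 hu0 ((hu0.trans hu78))
      calc u ^ 2 = u * u := sq u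
        _ ≤ C₁ * (p : ℝ) ^ (-(7 / 8) : ℝ) * (C₁ * (p : ℝ) ^ (-(7 / 8) : ℝ)) := h
        _ = C₁ ^ 2 * ((p : ℝ) ^ (-(7 / 8) : ℝ) * (p : ℝ) ^ (-(7 / 8) : ℝ)) := by ring
        _ = C₁ ^ 2 * (p : ℝ) ^ (-(7 / 4) : ℝ) := by rw [← Real.rpow_add hp0]; norm_num
    have hlogle : Real.log p ≤ (p : ℝ) ^ η / η := Real.log_le_rpow_div hp0.le hη
    have hlogle8 : Real.log p ≤ (p : ℝ) ^ (1 / 8 : ℝ) / (1 / 8) := Real.log_le_rpow_div hp0.le (by norm_num)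
    have hpow0 : (p : ℝ) ^ (-(7 / 4) : ℝ) * (p : ℝ) ^ (1 / 8 : ℝ) = ((p : ℝ) ^ (13 / 8 : ℝ))⁻¹ := by
      rw [← Real.rpow_add hp0, ← Real.rpow_neg hp0.le]
      norm_num
    have hpow : (p : ℝ) ^ (-(7 / 4) : ℝ) * ((p : ℝ) ^ (1 / 8 : ℝ) / (1 / 8)) =
        8 * ((p : ℝ) ^ (13 / 8 : ℝ))⁻¹ := by
      rw [← hpow0]
      ring
    calc Real.log p * gsharp A p ≤ Real.log p * (u + c₀⁻¹ * u ^ 2) :=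
          mul_le_mul_of_nonneg_left hgs_le hlogp
      _ ≤ Real.log p * (((p : ℝ)⁻¹ + |u - (p : ℝ)⁻¹|) + c₀⁻¹ * (C₁ ^ 2 * (p : ℝ) ^ (-(7 / 4) : ℝ))) := by
          gcongr
      _ = Real.log p / p + |u - (p : ℝ)⁻¹| * Real.log p +
            c₀⁻¹ * C₁ ^ 2 * ((p : ℝ) ^ (-(7 / 4) : ℝ) * Real.log p) := by ring
      _ ≤ Real.log p / p + |u - (p : ℝ)⁻¹| * ((p : ℝ) ^ η / η) +
            c₀⁻¹ * C₁ ^ 2 * ((p : ℝ) ^ (-(7 / 4) : ℝ) * ((p : ℝ) ^ (1 / 8 : ℝ) / (1 / 8))) := by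
          gcongr
      _ = _ := by rw [hpow]; ring
  -- Mertens part
  have hsub : Nat.primesBelow ⌈z⌉₊ ⊆ Nat.primesLE ⌊z⌋₊ := by
    intro p hp
    rw [Nat.mem_primesBelow] at hp
    rw [Nat.mem_primesLE]
    exact ⟨Nat.le_floor (Nat.lt_ceil.mp hp.1).le, hp.2⟩
  have hM : ∑ p ∈ Nat.primesBelow ⌈z⌉₊, Real.log p / p ≤ Real.log z + Real.log 4 := by
    calc ∑ p ∈ Nat.primesBelow ⌈z⌉₊, Real.log p / p ≤ ∑ p ∈ Nat.primesLE ⌊z⌋₊, Real.log p / p :=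
          Finset.sum_le_sum_of_subset_of_nonneg hsub fun p hp _ =>
            div_nonneg (Real.log_nonneg (by
              exact_mod_cast (Nat.prime_of_mem_primesLE hp).one_lt.le)) (Nat.cast_nonneg _)
      _ ≤ Real.log (⌊z⌋₊ : ℕ) + Real.log 4 := LFunctions.MertensBound.sum_log_div_prime_le _
      _ ≤ Real.log z + Real.log 4 := by
          gcongr
          · exact_mod_cast Nat.floor_pos.mpr (by linarith)
          · exact Nat.floor_le (by linarith)
  -- summable parts
  have hS : ∑ p ∈ Nat.primesBelow ⌈z⌉₊,
      (if p.Prime then |A.density p - (p : ℝ)⁻¹| * (p : ℝ) ^ η else 0) ≤ T :=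
    hsum.sum_le_tsum _ fun n _ => by split_ifs <;> positivity
  have hS' : ∑ p ∈ Nat.primesBelow ⌈z⌉₊, ((p : ℝ) ^ (13 / 8 : ℝ))⁻¹ ≤ Z :=
    hZs.sum_le_tsum _ fun n _ => by positivity
  calc ∑ p ∈ Nat.primesBelow ⌈z⌉₊, Real.log p * gsharp A p
      ≤ ∑ p ∈ Nat.primesBelow ⌈z⌉₊, (Real.log p / p +
          η⁻¹ * (if p.Prime then |A.density p - (p : ℝ)⁻¹| * (p : ℝ) ^ η else 0) +
          c₀⁻¹ * C₁ ^ 2 * 8 * ((p : ℝ) ^ (13 / 8 : ℝ))⁻¹) := Finset.sum_le_sum hpt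
    _ = ∑ p ∈ Nat.primesBelow ⌈z⌉₊, Real.log p / p +
          η⁻¹ * ∑ p ∈ Nat.primesBelow ⌈z⌉₊,
            (if p.Prime then |A.density p - (p : ℝ)⁻¹| * (p : ℝ) ^ η else 0) +
          c₀⁻¹ * C₁ ^ 2 * 8 * ∑ p ∈ Nat.primesBelow ⌈z⌉₊, ((p : ℝ) ^ (13 / 8 : ℝ))⁻¹ := by
        rw [Finset.sum_add_distrib, Finset.sum_add_distrib, Finset.mul_sum, Finset.mul_sum]
    _ ≤ (Real.log z + Real.log 4) + η⁻¹ * T + c₀⁻¹ * C₁ ^ 2 * 8 * Z := by gcongr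
    _ = Real.log z + (Real.log 4 + T / η + c₀⁻¹ * C₁ ^ 2 * 8 * Z) := by ring

/-- **Mertens for `Λ · g♯` with constant one, `z`-restricted form**: under (A₁), (A₅), `g ≥ 0`
there is `C₀ ≥ 0` with `∑_{d ≤ t, minFac d < z} Λ(d) g♯(d) ≤ log z + C₀` for all `t ≥ 0`, `z ≥ 2`
(the primes `p < z` by `sum_primesBelow_log_mul_gsharp_le`; the higher prime powers are `O(1)`
uniformly by (A₁), `sum_higherPrimePow_abs_density_mul_log_le`, `gsharp_le_of_isPrimePow`).
[cite: FriedlanderIwaniecPisa1978, Lemma 13 (proof, pp. 740-741)] -/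
theorem sum_vonMangoldt_mul_gsharp_minFac_le (A : SieveSequence) (h1 : A.BombieriA1)
    (h5 : A.BombieriA5) (hg0 : ∀ d : ℕ, 1 ≤ d → 0 ≤ A.density d) :
    ∃ C₀ : ℝ, 0 ≤ C₀ ∧ ∀ t z : ℝ, 0 ≤ t → 2 ≤ z →
      ∑ d ∈ (Ioc 0 ⌊t⌋₊).filter (fun d : ℕ => (d.minFac : ℝ) < z), Λ d * gsharp A d ≤
        Real.log z + C₀ := by
  have hg1 : ∀ p : ℕ, p.Prime → A.density p < 1 := fun p hp => h1.2 p hp.one_lt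
  obtain ⟨c₀, hc₀, -, hgap⟩ := exists_one_sub_density_ge A h1
  obtain ⟨C, hC0, hC⟩ := sum_primesBelow_log_mul_gsharp_le A h1 h5 hg0
  obtain ⟨C₂, hC₂0, hC₂⟩ := sum_higherPrimePow_abs_density_mul_log_le A h1
  refine ⟨C + c₀⁻¹ * C₂, by positivity, fun t z ht hz => ?_⟩
  set S := (Ioc 0 ⌊t⌋₊).filter (fun d : ℕ => (d.minFac : ℝ) < z) with hS
  have hgs0 : ∀ n, 0 ≤ gsharp A n := gsharp_nonneg hg0 hg1
  have hterm0 : ∀ d, 0 ≤ Λ d * gsharp A d := fun d => mul_nonneg ArithmeticFunction.vonMangoldt_nonneg (hgs0 d)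
  -- split `S` by `Prime` and `IsPrimePow ∧ ¬ Prime`; the rest carries `Λ = 0`
  have hsplit : ∑ d ∈ S, Λ d * gsharp A d =
      ∑ d ∈ S.filter Nat.Prime, Λ d * gsharp A d +
        ∑ d ∈ (S.filter (fun d => ¬ d.Prime)).filter IsPrimePow, Λ d * gsharp A d := by
    rw [← Finset.sum_filter_add_sum_filter_not S Nat.Prime]
    congr 1
    rw [← Finset.sum_filter_add_sum_filter_not (S.filter (fun d => ¬ d.Prime)) IsPrimePow]
    have hzero : ∑ d ∈ (S.filter (fun d => ¬ d.Prime)).filter (fun d => ¬ IsPrimePow d),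
        Λ d * gsharp A d = 0 :=
      Finset.sum_eq_zero fun d hd => by
        rw [ArithmeticFunction.vonMangoldt_eq_zero_iff.mpr (Finset.mem_filter.mp hd).2, zero_mul]
    rw [hzero, add_zero]
  -- primes: inject into `primesBelow ⌈z⌉`
  have hprimes : ∑ d ∈ S.filter Nat.Prime, Λ d * gsharp A d ≤ Real.log z + C := by
    have hsub : S.filter Nat.Prime ⊆ Nat.primesBelow ⌈z⌉₊ := by
      intro p hp
      rw [Finset.mem_filter, hS, Finset.mem_filter] at hp
      obtain ⟨⟨-, hlt⟩, hpp⟩ := hp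
      rw [hpp.minFac_eq] at hlt
      exact Nat.mem_primesBelow.mpr ⟨Nat.lt_ceil.mpr hlt, hpp⟩
    calc ∑ d ∈ S.filter Nat.Prime, Λ d * gsharp A d
        ≤ ∑ p ∈ Nat.primesBelow ⌈z⌉₊, Λ p * gsharp A p :=
          Finset.sum_le_sum_of_subset_of_nonneg hsub fun d _ _ => hterm0 d
      _ = ∑ p ∈ Nat.primesBelow ⌈z⌉₊, Real.log p * gsharp A p :=
          Finset.sum_congr rfl fun p hp => by
            rw [ArithmeticFunction.vonMangoldt_apply_prime (Nat.prime_of_mem_primesBelow hp)]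
      _ ≤ Real.log z + C := hC z hz
  -- higher prime powers
  have hhigher : ∑ d ∈ (S.filter (fun d => ¬ d.Prime)).filter IsPrimePow, Λ d * gsharp A d ≤
      c₀⁻¹ * C₂ := by
    have hsub : (S.filter (fun d => ¬ d.Prime)).filter IsPrimePow ⊆
        (Ioc 0 ⌊t⌋₊).filter (fun n : ℕ => IsPrimePow n ∧ ¬ n.Prime) := by
      intro d hd
      rw [Finset.mem_filter, Finset.mem_filter, hS, Finset.mem_filter] at hd
      exact Finset.mem_filter.mpr ⟨hd.1.1.1, hd.2, hd.1.2⟩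
    have hpt : ∀ d ∈ (Ioc 0 ⌊t⌋₊).filter (fun n : ℕ => IsPrimePow n ∧ ¬ n.Prime),
        Λ d * gsharp A d ≤ c₀⁻¹ * (|A.density d| * Real.log d) := by
      intro d hd
      have hpp : IsPrimePow d := (Finset.mem_filter.mp hd).2.1
      have hlog : 0 ≤ Real.log d := Real.log_natCast_nonneg d
      calc Λ d * gsharp A d ≤ Real.log d * (|A.density d| / c₀) :=
            mul_le_mul ArithmeticFunction.vonMangoldt_le_log (gsharp_le_of_isPrimePow hc₀ hgap hpp)
              (hgs0 d) hlog
        _ = c₀⁻¹ * (|A.density d| * Real.log d) := by rw [div_eq_mul_inv]; ring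
    calc ∑ d ∈ (S.filter (fun d => ¬ d.Prime)).filter IsPrimePow, Λ d * gsharp A d
        ≤ ∑ d ∈ (Ioc 0 ⌊t⌋₊).filter (fun n : ℕ => IsPrimePow n ∧ ¬ n.Prime), Λ d * gsharp A d :=
          Finset.sum_le_sum_of_subset_of_nonneg hsub fun d _ _ => hterm0 d
      _ ≤ ∑ d ∈ (Ioc 0 ⌊t⌋₊).filter (fun n : ℕ => IsPrimePow n ∧ ¬ n.Prime),
            c₀⁻¹ * (|A.density d| * Real.log d) := Finset.sum_le_sum hpt
      _ = c₀⁻¹ * ∑ d ∈ (Ioc 0 ⌊t⌋₊).filter (fun n : ℕ => IsPrimePow n ∧ ¬ n.Prime),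
            |A.density d| * Real.log d := by rw [Finset.mul_sum]
      _ ≤ c₀⁻¹ * C₂ := mul_le_mul_of_nonneg_left (hC₂ t ht) (by positivity)
  rw [hsplit]
  linarith

/-- **Mertens for `Λ · g♯` with constant one**: under (A₁), (A₅), `g ≥ 0` there is `C₀ ≥ 0` with
`∑_{d ≤ t} Λ(d) g♯(d) ≤ log t + C₀` for all `t ≥ 1` (the previous bound with `z = t + 1`,
`log (t+1) ≤ log t + log 2`). This is the analogue, for the density `g♯`, of
`∑_{m ≤ x/n} Λ(m)/m = log x/n + O(1)` in the proof of [FriedlanderIwaniecPisa1978] Lemma 2 (p. 726).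
[cite: FriedlanderIwaniecPisa1978, Lemma 2 (proof, p. 726)] -/
theorem sum_vonMangoldt_mul_gsharp_le (A : SieveSequence) (h1 : A.BombieriA1)
    (h5 : A.BombieriA5) (hg0 : ∀ d : ℕ, 1 ≤ d → 0 ≤ A.density d) :
    ∃ C₀ : ℝ, 0 ≤ C₀ ∧ ∀ t : ℝ, 1 ≤ t →
      ∑ d ∈ Ioc 0 ⌊t⌋₊, Λ d * gsharp A d ≤ Real.log t + C₀ := by
  obtain ⟨C₀, hC₀0, hC₀⟩ := sum_vonMangoldt_mul_gsharp_minFac_le A h1 h5 hg0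
  refine ⟨C₀ + Real.log 2, by positivity, fun t ht => ?_⟩
  have ht0 : 0 < t := by linarith
  have hall : (Ioc 0 ⌊t⌋₊).filter (fun d : ℕ => (d.minFac : ℝ) < t + 1) = Ioc 0 ⌊t⌋₊ := by
    refine Finset.filter_true_of_mem fun d hd => ?_
    obtain ⟨hd0, hdt⟩ := Finset.mem_Ioc.mp hd
    have hdt' : (d : ℝ) ≤ t := le_trans (by exact_mod_cast hdt) (Nat.floor_le ht0.le)
    have hmf : (d.minFac : ℝ) ≤ d := by exact_mod_cast Nat.minFac_le hd0
    linarith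
  have h := hC₀ t (t + 1) ht0.le (by linarith)
  rw [hall] at h
  have hlog : Real.log (t + 1) ≤ Real.log t + Real.log 2 := by
    rw [← Real.log_mul ht0.ne' two_ne_zero]
    exact Real.log_le_log (by linarith) (by linarith)
  linarith

/-! ### The weights of the non-coprime pairs: `∑_{p, a, b ≥ 1} log p · Λ_i(p^b) g♯(p^{a+b})` -/

/-- `Λ_i(n) ≤ (log n)^i` for ALL `i` once `n ≠ 1` (for `i ≥ 1` this is `generalizedVonMangoldt_le`;
for `i = 0`, `Λ_0(n) = [n = 1] = 0`). [folklore] -/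
theorem generalizedVonMangoldt_le_pow_log_of_ne_one (i : ℕ) {n : ℕ} (hn : n ≠ 1) :
    generalizedVonMangoldt i n ≤ Real.log n ^ i := by
  rcases Nat.eq_zero_or_pos i with rfl | hi
  · rw [generalizedVonMangoldt_zero_apply, if_neg hn, pow_zero]
    exact zero_le_one
  · exact generalizedVonMangoldt_le hi n

/-- The exponential trick of [FriedlanderIwaniecPisa1978] p. 741 ("since `e^u > u^j/j!`"):
`(log u)^i ≤ 8^i · i! · u^{1/8}` for `u > 0` (take `t = (log u)/8` in `t^i/i! ≤ e^t`).
[cite: FriedlanderIwaniecPisa1978, Lemma 13 (proof, p. 741)] -/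
theorem pow_log_le_factorial_mul_rpow {u : ℝ} (hu : 0 < u) (hlog : 0 ≤ Real.log u) (i : ℕ) :
    Real.log u ^ i ≤ (8 : ℝ) ^ i * i ! * u ^ (1 / 8 : ℝ) := by
  set t : ℝ := Real.log u * (1 / 8) with ht
  have ht0 : 0 ≤ t := by positivity
  have hexp : Real.exp t = u ^ (1 / 8 : ℝ) := by rw [Real.rpow_def_of_pos hu]
  have hfac : (0 : ℝ) < i ! := by exact_mod_cast Nat.factorial_pos i
  have h := Real.pow_div_factorial_le_exp t ht0 i
  rw [div_le_iff₀ hfac, hexp] at h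
  have hlog : Real.log u = 8 * t := by rw [ht]; ring
  calc Real.log u ^ i = (8 : ℝ) ^ i * t ^ i := by rw [hlog, mul_pow]
    _ ≤ (8 : ℝ) ^ i * (u ^ (1 / 8 : ℝ) * i !) := mul_le_mul_of_nonneg_left h (by positivity)
    _ = (8 : ℝ) ^ i * i ! * u ^ (1 / 8 : ℝ) := by ring

/-- **The weights of the non-coprime pairs are `O(8^i i!)`**: under (A₁) and `g ≥ 0` there is
`K ≥ 0` with `∑_{p ≤ N} ∑_{a, b ≥ 1} log p · Λ_i(p^b) g♯(p^{a+b}) ≤ K 8^i i!` for all `i`,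
uniformly in the ranges (written with `a = a' + 1`, `b = b' + 1`, `a', b' < B`). With
`q = p^{1/8}`: `log p ≤ 8q`, `Λ_i(p^b) ≤ 8^i i! q^b` (`pow_log_le_factorial_mul_rpow`),
`g♯(p^{a+b}) ≤ c₀⁻¹ C₁ q^{−7(a+b)}` ((A₁), `gsharp_le_of_isPrimePow`), so each term is
`≤ 8 c₀⁻¹ C₁ 8^i i! · q^{−12} (q^{−7})^{a'} (q^{−6})^{b'}` with `q^{−6} ≤ q^{−7}·q ≤ 3/5`... precisely
`q^6 = p^{3/4} ≥ 2^{3/4} ≥ 5/3`, and `∑_p q^{−12} = ∑_p p^{−3/2} < ∞`. These are the terms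
`h ∣ δ^∞` of the proof of [FriedlanderIwaniecPisa1978] Lemma 13.
[cite: FriedlanderIwaniecPisa1978, Lemma 13 (proof, p. 741)] -/
theorem sum_primePowPair_weight_le (A : SieveSequence) (h1 : A.BombieriA1)
    (hg0 : ∀ d : ℕ, 1 ≤ d → 0 ≤ A.density d) :
    ∃ K : ℝ, 0 ≤ K ∧ ∀ i N B : ℕ,
      ∑ p ∈ (Ioc 0 N).filter Nat.Prime, ∑ ab ∈ range B ×ˢ range B,
          Real.log p * generalizedVonMangoldt i (p ^ (ab.2 + 1)) *
            gsharp A (p ^ (ab.1 + ab.2 + 2)) ≤ K * (8 : ℝ) ^ i * i ! := by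
  obtain ⟨c₀, hc₀, -, hgap⟩ := exists_one_sub_density_ge A h1
  obtain ⟨C₁, hC₁0, hC₁⟩ := abs_density_le_rpow78 A h1
  have hZs : Summable (fun n : ℕ => ((n : ℝ) ^ (3 / 2 : ℝ))⁻¹) :=
    Real.summable_nat_rpow_inv.mpr (by norm_num)
  set Z : ℝ := ∑' n : ℕ, ((n : ℝ) ^ (3 / 2 : ℝ))⁻¹ with hZ
  have hZ0 : 0 ≤ Z := tsum_nonneg fun n => by positivity
  refine ⟨8 * (C₁ / c₀) * (25 / 4) * Z, by positivity, fun i N B => ?_⟩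
  set M : ℝ := 8 * (C₁ / c₀) * ((8 : ℝ) ^ i * i !) with hM
  have hM0 : 0 ≤ M := by positivity
  -- geometric sums over the exponents
  have hgeom : ∑ a ∈ range B, (3 / 5 : ℝ) ^ a ≤ 5 / 2 := by
    have h := geom_sum_Ico_le_of_lt_one (x := (3 / 5 : ℝ)) (m := 0) (n := B) (by norm_num)
      (by norm_num)
    rw [← Finset.range_eq_Ico, pow_zero] at h
    exact h.trans (by norm_num)
  have hgeom2 : ∑ ab ∈ range B ×ˢ range B, (3 / 5 : ℝ) ^ ab.1 * (3 / 5 : ℝ) ^ ab.2 ≤ 25 / 4 := by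
    have hprod : ∑ ab ∈ range B ×ˢ range B, (3 / 5 : ℝ) ^ ab.1 * (3 / 5 : ℝ) ^ ab.2 =
        (∑ a ∈ range B, (3 / 5 : ℝ) ^ a) * ∑ a ∈ range B, (3 / 5 : ℝ) ^ a := by
      rw [Finset.sum_mul_sum, Finset.sum_product]
    rw [hprod]
    have h0 : 0 ≤ ∑ a ∈ range B, (3 / 5 : ℝ) ^ a := Finset.sum_nonneg fun a _ => by positivity
    calc (∑ a ∈ range B, (3 / 5 : ℝ) ^ a) * ∑ a ∈ range B, (3 / 5 : ℝ) ^ a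
        ≤ (5 / 2) * (5 / 2) := mul_le_mul hgeom hgeom h0 (by norm_num)
      _ = 25 / 4 := by norm_num
  -- the bound at a fixed prime
  have hprime : ∀ p ∈ (Ioc 0 N).filter Nat.Prime,
      ∑ ab ∈ range B ×ˢ range B, Real.log p * generalizedVonMangoldt i (p ^ (ab.2 + 1)) *
          gsharp A (p ^ (ab.1 + ab.2 + 2)) ≤ M * (25 / 4) * ((p : ℝ) ^ (3 / 2 : ℝ))⁻¹ := by
    intro p hp
    have hpp : p.Prime := (Finset.mem_filter.mp hp).2
    have hp0 : (0 : ℝ) < p := by exact_mod_cast hpp.pos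
    have hp2 : (2 : ℝ) ≤ p := by exact_mod_cast hpp.two_le
    set q : ℝ := (p : ℝ) ^ (1 / 8 : ℝ) with hq
    have hq0 : 0 < q := Real.rpow_pos_of_pos hp0 _
    have hq1 : 1 ≤ q := Real.one_le_rpow (by linarith) (by norm_num)
    -- `q^n = p^{n/8}`
    have hqpow : ∀ n : ℕ, q ^ n = (p : ℝ) ^ ((n : ℝ) / 8) := by
      intro n
      rw [hq, ← Real.rpow_natCast, ← Real.rpow_mul hp0.le]
      congr 1; ring
    have hq12 : q ^ 12 = (p : ℝ) ^ (3 / 2 : ℝ) := by rw [hqpow]; norm_num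
    -- `q^6 ≥ 5/3`
    have hq6 : (5 / 3 : ℝ) ≤ q ^ 6 := by
      have h24 : (q ^ 6) ^ 4 = (p : ℝ) ^ (3 : ℕ) := by
        rw [← pow_mul, hqpow, ← Real.rpow_natCast]; norm_num
      have h8 : (8 : ℝ) ≤ (p : ℝ) ^ (3 : ℕ) := by
        have h := pow_le_pow_left₀ (by norm_num : (0 : ℝ) ≤ 2) hp2 3
        norm_num at h
        exact h
      refine le_of_pow_le_pow_left₀ (by norm_num : (4 : ℕ) ≠ 0) (by positivity) ?_
      rw [h24]
      exact le_trans (by norm_num) h8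
    have hq6inv : (q ^ 6)⁻¹ ≤ 3 / 5 := by
      rw [inv_le_comm₀ (by positivity) (by norm_num)]
      exact le_trans (by norm_num) hq6
    -- the three factors
    have hlogp : Real.log p ≤ 8 * q := by
      have h := Real.log_le_rpow_div hp0.le (by norm_num : (0 : ℝ) < 1 / 8)
      rw [← hq] at h
      linarith [h, show q / (1 / 8) = 8 * q by ring]
    have hlogp0 : 0 ≤ Real.log p := Real.log_nonneg (by linarith)
    have hterm : ∀ ab ∈ range B ×ˢ range B,
        Real.log p * generalizedVonMangoldt i (p ^ (ab.2 + 1)) * gsharp A (p ^ (ab.1 + ab.2 + 2)) ≤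
          M * ((p : ℝ) ^ (3 / 2 : ℝ))⁻¹ * ((3 / 5 : ℝ) ^ ab.1 * (3 / 5 : ℝ) ^ ab.2) := by
      rintro ⟨a, b⟩ -
      dsimp only
      -- `Λ_i(p^{b+1}) ≤ 8^i i! q^{b+1}`
      have hpb0 : (0 : ℝ) < (p : ℝ) ^ (b + 1) := by positivity
      have hpb1 : (1 : ℝ) ≤ (p : ℝ) ^ (b + 1) := one_le_pow₀ (by linarith)
      have hne1 : p ^ (b + 1) ≠ 1 := (Nat.one_lt_pow b.succ_ne_zero hpp.one_lt).ne'
      have hlam : generalizedVonMangoldt i (p ^ (b + 1)) ≤ (8 : ℝ) ^ i * i ! * q ^ (b + 1) := by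
        have h1' := generalizedVonMangoldt_le_pow_log_of_ne_one i hne1
        rw [Nat.cast_pow] at h1'
        have h2' := pow_log_le_factorial_mul_rpow hpb0 (Real.log_nonneg hpb1) i
        have h3' : ((p : ℝ) ^ (b + 1)) ^ (1 / 8 : ℝ) = q ^ (b + 1) := by
          rw [hq, ← Real.rpow_natCast, ← Real.rpow_mul hp0.le, mul_comm, Real.rpow_mul hp0.le,
            Real.rpow_natCast]
        rw [h3'] at h2'
        exact h1'.trans h2'
      have hlam0 : 0 ≤ generalizedVonMangoldt i (p ^ (b + 1)) := generalizedVonMangoldt_nonneg _ _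
      -- `g♯(p^{a+b+2}) ≤ (C₁/c₀) q^{-7(a+b+2)}`
      have hppow : IsPrimePow (p ^ (a + b + 2)) := hpp.isPrimePow.pow (by omega)
      have hgs : gsharp A (p ^ (a + b + 2)) ≤ C₁ / c₀ * (q ^ (7 * (a + b + 2)))⁻¹ := by
        refine (gsharp_le_of_isPrimePow hc₀ hgap hppow).trans ?_
        have h := hC₁ (p ^ (a + b + 2)) (Nat.one_le_pow _ _ hpp.pos)
        rw [Nat.cast_pow] at h
        have hrp : ((p : ℝ) ^ (a + b + 2)) ^ (-(7 / 8) : ℝ) = (q ^ (7 * (a + b + 2)))⁻¹ := by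
          rw [hqpow, ← Real.rpow_natCast, ← Real.rpow_mul hp0.le, ← Real.rpow_neg hp0.le]
          congr 1; push_cast; ring
        rw [hrp] at h
        rw [div_le_iff₀ hc₀]
        calc |A.density (p ^ (a + b + 2))| ≤ C₁ * (q ^ (7 * (a + b + 2)))⁻¹ := h
          _ = C₁ / c₀ * (q ^ (7 * (a + b + 2)))⁻¹ * c₀ := by field_simp
      have hgs0 : 0 ≤ gsharp A (p ^ (a + b + 2)) :=
        gsharp_nonneg hg0 (fun p hp => h1.2 p hp.one_lt) _
      -- the powers of `q`
      have hq7 : (5 / 3 : ℝ) ≤ q ^ 7 := hq6.trans (pow_le_pow_right₀ hq1 (by norm_num))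
      have hcalc : (8 * q) * ((8 : ℝ) ^ i * i ! * q ^ (b + 1)) * (C₁ / c₀ * (q ^ (7 * (a + b + 2)))⁻¹) =
          M * (q ^ (b + 2) * (q ^ (7 * (a + b + 2)))⁻¹) := by
        rw [hM]; ring
      have e1 : q ^ (7 * (a + b + 2)) = q ^ (b + 2) * ((q ^ 7) ^ a * (q ^ 6) ^ b * q ^ 12) := by
        rw [← pow_mul, ← pow_mul, ← pow_add, ← pow_add, ← pow_add]
        congr 1; ring
      have e2 : q ^ (b + 2) * (q ^ (7 * (a + b + 2)))⁻¹ = ((q ^ 7) ^ a * (q ^ 6) ^ b * q ^ 12)⁻¹ := by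
        rw [e1, mul_inv, ← mul_assoc, mul_inv_cancel₀ (pow_ne_zero _ hq0.ne'), one_mul]
      have hW : (5 / 3 : ℝ) ^ a * (5 / 3) ^ b * q ^ 12 ≤ (q ^ 7) ^ a * (q ^ 6) ^ b * q ^ 12 := by
        gcongr
      have hW0 : 0 < (5 / 3 : ℝ) ^ a * (5 / 3) ^ b * q ^ 12 := by positivity
      have e3 : ((5 / 3 : ℝ) ^ a * (5 / 3) ^ b * q ^ 12)⁻¹ = (q ^ 12)⁻¹ * ((3 / 5 : ℝ) ^ a * (3 / 5 : ℝ) ^ b) := by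
        rw [mul_inv, mul_inv, ← inv_pow, ← inv_pow, show (5 / 3 : ℝ)⁻¹ = 3 / 5 by norm_num]
        ring
      calc Real.log p * generalizedVonMangoldt i (p ^ (b + 1)) * gsharp A (p ^ (a + b + 2))
          ≤ (8 * q) * ((8 : ℝ) ^ i * i ! * q ^ (b + 1)) * (C₁ / c₀ * (q ^ (7 * (a + b + 2)))⁻¹) :=
            mul_le_mul (mul_le_mul hlogp hlam hlam0 (by positivity)) hgs hgs0 (by positivity)
        _ = M * ((q ^ 7) ^ a * (q ^ 6) ^ b * q ^ 12)⁻¹ := by rw [hcalc, e2]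
        _ ≤ M * ((5 / 3 : ℝ) ^ a * (5 / 3) ^ b * q ^ 12)⁻¹ :=
            mul_le_mul_of_nonneg_left (inv_anti₀ hW0 hW) hM0
        _ = M * ((p : ℝ) ^ (3 / 2 : ℝ))⁻¹ * ((3 / 5 : ℝ) ^ a * (3 / 5 : ℝ) ^ b) := by
            rw [e3, hq12]; ring
    calc _ ≤ ∑ ab ∈ range B ×ˢ range B,
          M * ((p : ℝ) ^ (3 / 2 : ℝ))⁻¹ * ((3 / 5 : ℝ) ^ ab.1 * (3 / 5 : ℝ) ^ ab.2) :=
          Finset.sum_le_sum hterm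
      _ = M * ((p : ℝ) ^ (3 / 2 : ℝ))⁻¹ *
            ∑ ab ∈ range B ×ˢ range B, (3 / 5 : ℝ) ^ ab.1 * (3 / 5 : ℝ) ^ ab.2 := by
          rw [Finset.mul_sum]
      _ ≤ M * ((p : ℝ) ^ (3 / 2 : ℝ))⁻¹ * (25 / 4) :=
          mul_le_mul_of_nonneg_left hgeom2 (by positivity)
      _ = M * (25 / 4) * ((p : ℝ) ^ (3 / 2 : ℝ))⁻¹ := by ring
  -- summing over the primes
  have hsumZ : ∑ p ∈ (Ioc 0 N).filter Nat.Prime, ((p : ℝ) ^ (3 / 2 : ℝ))⁻¹ ≤ Z :=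
    calc ∑ p ∈ (Ioc 0 N).filter Nat.Prime, ((p : ℝ) ^ (3 / 2 : ℝ))⁻¹
        ≤ ∑ p ∈ Ioc 0 N, ((p : ℝ) ^ (3 / 2 : ℝ))⁻¹ :=
          Finset.sum_le_sum_of_subset_of_nonneg (Finset.filter_subset _ _) fun p _ _ => by positivity
      _ ≤ Z := hZs.sum_le_tsum _ fun n _ => by positivity
  calc _ ≤ ∑ p ∈ (Ioc 0 N).filter Nat.Prime, M * (25 / 4) * ((p : ℝ) ^ (3 / 2 : ℝ))⁻¹ :=
        Finset.sum_le_sum hprime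
    _ = M * (25 / 4) * ∑ p ∈ (Ioc 0 N).filter Nat.Prime, ((p : ℝ) ^ (3 / 2 : ℝ))⁻¹ := by
        rw [Finset.mul_sum]
    _ ≤ M * (25 / 4) * Z := mul_le_mul_of_nonneg_left hsumZ (by positivity)
    _ = 8 * (C₁ / c₀) * (25 / 4) * Z * (8 : ℝ) ^ i * i ! := by rw [hM]; ring

/-! ### The recursion `Λ_{j+1} = Λ_j log + Λ ⋆ Λ_j` for the weighted sums: bookkeeping -/

/-- Reordering a sum over `n ≤ N` and the factorisations `n = d m` as a sum over the pairs
`(d, m)` with `d m ≤ N` (the general-weight form of Mathlib's `sum_Ioc_mul_eq_sum_prod_filter`).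
[folklore] -/
theorem sum_Ioc_sum_divisorsAntidiagonal_eq (N : ℕ) (G : ℕ × ℕ → ℝ) :
    ∑ n ∈ Ioc 0 N, ∑ x ∈ n.divisorsAntidiagonal, G x =
      ∑ x ∈ (Ioc 0 N ×ˢ Ioc 0 N).filter (fun x : ℕ × ℕ => x.1 * x.2 ≤ N), G x := by
  classical
  calc ∑ n ∈ Ioc 0 N, ∑ x ∈ n.divisorsAntidiagonal, G x
      = ∑ n ∈ Ioc 0 N, ∑ x ∈ (Ioc 0 N ×ˢ Ioc 0 N).filter (fun x : ℕ × ℕ => x.1 * x.2 = n), G x := by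
        refine Finset.sum_congr rfl fun n hn => ?_
        rw [Finset.mem_Ioc] at hn
        rw [Nat.divisorsAntidiagonal_eq_prod_filter_of_le hn.1.ne' hn.2]
    _ = ∑ n ∈ Ioc 0 N, ∑ x ∈ Ioc 0 N ×ˢ Ioc 0 N, (if x.1 * x.2 = n then G x else 0) := by
        simp only [Finset.sum_filter]
    _ = ∑ x ∈ Ioc 0 N ×ˢ Ioc 0 N, ∑ n ∈ Ioc 0 N, (if x.1 * x.2 = n then G x else 0) :=
        Finset.sum_comm
    _ = ∑ x ∈ Ioc 0 N ×ˢ Ioc 0 N, (if x.1 * x.2 ≤ N then G x else 0) := by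
        refine Finset.sum_congr rfl fun x hx => ?_
        rw [Finset.sum_ite_eq]
        obtain ⟨h1, h2⟩ := Finset.mem_product.mp hx
        have h1' := (Finset.mem_Ioc.mp h1).1
        have h2' := (Finset.mem_Ioc.mp h2).1
        have hpos : 0 < x.1 * x.2 := Nat.mul_pos h1' h2'
        by_cases hle : x.1 * x.2 ≤ N
        · rw [if_pos (Finset.mem_Ioc.mpr ⟨hpos, hle⟩), if_pos hle]
        · rw [if_neg (fun h => hle (Finset.mem_Ioc.mp h).2), if_neg hle]
    _ = _ := by rw [Finset.sum_filter]

/-- **The recursion for the weighted sums**: for any index set `S ⊆ {1, …, N}` and weight `h`,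
`∑_{n ∈ S} Λ_{j+1}(n) h(n) = ∑_{n ∈ S} Λ_j(n) h(n) log n + ∑_{n ∈ S} ∑_{dm = n} h(n) Λ(d) Λ_j(m)`
(`generalizedVonMangoldt_succ_apply`). [folklore] -/
theorem sum_generalizedVonMangoldt_succ_mul_eq (j : ℕ) (S : Finset ℕ) (h : ℕ → ℝ) :
    ∑ n ∈ S, generalizedVonMangoldt (j + 1) n * h n =
      ∑ n ∈ S, generalizedVonMangoldt j n * h n * Real.log n +
        ∑ n ∈ S, ∑ x ∈ n.divisorsAntidiagonal, h n * (Λ x.1 * generalizedVonMangoldt j x.2) := by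
  rw [← Finset.sum_add_distrib]
  refine Finset.sum_congr rfl fun n _ => ?_
  rw [generalizedVonMangoldt_succ_apply, add_mul, Finset.sum_mul]
  congr 1
  · ring
  · exact Finset.sum_congr rfl fun x _ => by ring

/-- **The coprime pairs.** For the pair sum restricted to coprime `(d, m)` with `m` in a set `M`
and `d` satisfying a condition `Q`: since `g♯(dm) = g♯(d) g♯(m)`,
`∑ g♯(dm) Λ(d) Λ_j(m) ≤ ∑_{m ∈ M} Λ_j(m) g♯(m) ∑_{d ≤ N/m, Q d} Λ(d) g♯(d)` (all terms being
nonnegative, the coprimality may be dropped after the factorisation). [folklore] -/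
theorem sum_coprime_pairs_le (A : SieveSequence) (hg0 : ∀ d : ℕ, 1 ≤ d → 0 ≤ A.density d)
    (hg1 : ∀ p : ℕ, p.Prime → A.density p < 1) (j N : ℕ) (M : Finset ℕ) (hM : M ⊆ Ioc 0 N)
    (Q : ℕ → Prop) [DecidablePred Q] :
    ∑ x ∈ ((Ioc 0 N ×ˢ Ioc 0 N).filter (fun x : ℕ × ℕ => x.1 * x.2 ≤ N)).filter
        (fun x : ℕ × ℕ => x.1.Coprime x.2 ∧ x.2 ∈ M ∧ Q x.1),
        gsharp A (x.1 * x.2) * (Λ x.1 * generalizedVonMangoldt j x.2) ≤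
      ∑ m ∈ M, generalizedVonMangoldt j m * gsharp A m *
        ∑ d ∈ (Ioc 0 (N / m)).filter Q, Λ d * gsharp A d := by
  classical
  have hgs : ∀ n, 0 ≤ gsharp A n := gsharp_nonneg hg0 hg1
  -- rewrite each term through `g♯(dm) = g♯(d) g♯(m)` and pass to an indicator over the box
  set F : ℕ × ℕ → ℝ := fun x => (generalizedVonMangoldt j x.2 * gsharp A x.2) *
    (if x.1 * x.2 ≤ N ∧ Q x.1 then Λ x.1 * gsharp A x.1 else 0) with hF
  have hF0 : ∀ x, 0 ≤ F x := fun x => by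
    simp only [hF]
    split_ifs
    · exact mul_nonneg (mul_nonneg (generalizedVonMangoldt_nonneg _ _) (hgs _))
        (mul_nonneg ArithmeticFunction.vonMangoldt_nonneg (hgs _))
    · rw [mul_zero]
  have hstep1 : ∑ x ∈ ((Ioc 0 N ×ˢ Ioc 0 N).filter (fun x : ℕ × ℕ => x.1 * x.2 ≤ N)).filter
        (fun x : ℕ × ℕ => x.1.Coprime x.2 ∧ x.2 ∈ M ∧ Q x.1),
        gsharp A (x.1 * x.2) * (Λ x.1 * generalizedVonMangoldt j x.2) ≤
      ∑ x ∈ Ioc 0 N ×ˢ M, F x := by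
    have hsub : ((Ioc 0 N ×ˢ Ioc 0 N).filter (fun x : ℕ × ℕ => x.1 * x.2 ≤ N)).filter
        (fun x : ℕ × ℕ => x.1.Coprime x.2 ∧ x.2 ∈ M ∧ Q x.1) ⊆ Ioc 0 N ×ˢ M := by
      intro x hx
      simp only [Finset.mem_filter, Finset.mem_product] at hx
      exact Finset.mem_product.mpr ⟨hx.1.1.1, hx.2.2.1⟩
    have heq : ∀ x ∈ ((Ioc 0 N ×ˢ Ioc 0 N).filter (fun x : ℕ × ℕ => x.1 * x.2 ≤ N)).filter
        (fun x : ℕ × ℕ => x.1.Coprime x.2 ∧ x.2 ∈ M ∧ Q x.1),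
        gsharp A (x.1 * x.2) * (Λ x.1 * generalizedVonMangoldt j x.2) = F x := by
      intro x hx
      simp only [Finset.mem_filter] at hx
      simp only [hF, if_pos (And.intro hx.1.2 hx.2.2.2), gsharp_mul hx.2.1]
      ring
    rw [Finset.sum_congr rfl heq]
    exact Finset.sum_le_sum_of_subset_of_nonneg hsub fun x _ _ => hF0 x
  refine hstep1.trans (le_of_eq ?_)
  rw [Finset.sum_product_right]
  refine Finset.sum_congr rfl fun m hm => ?_
  have hm1 : 0 < m := (Finset.mem_Ioc.mp (hM hm)).1
  simp only [hF, ← Finset.mul_sum]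
  congr 1
  rw [Finset.sum_filter]
  -- `{d ≤ N : d m ≤ N} = {d ≤ N/m}`
  have hsub : Ioc 0 (N / m) ⊆ Ioc 0 N := Finset.Ioc_subset_Ioc_right (Nat.div_le_self _ _)
  calc (∑ d ∈ Ioc 0 N, if d * m ≤ N ∧ Q d then Λ d * gsharp A d else 0)
      = ∑ d ∈ Ioc 0 (N / m), (if d * m ≤ N ∧ Q d then Λ d * gsharp A d else 0) := by
        refine (Finset.sum_subset hsub fun d hd hdn => ?_).symm
        have hdn' : ¬ (d * m ≤ N) := fun h => hdn (Finset.mem_Ioc.mpr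
          ⟨(Finset.mem_Ioc.mp hd).1, (Nat.le_div_iff_mul_le hm1).mpr h⟩)
        rw [if_neg (fun h => hdn' h.1)]
    _ = ∑ d ∈ Ioc 0 (N / m), (if Q d then Λ d * gsharp A d else 0) := by
        refine Finset.sum_congr rfl fun d hd => ?_
        have hdm : d * m ≤ N := (Nat.le_div_iff_mul_le hm1).mp (Finset.mem_Ioc.mp hd).2
        by_cases hQ : Q d
        · rw [if_pos ⟨hdm, hQ⟩, if_pos hQ]
        · rw [if_neg (fun h => hQ h.2), if_neg hQ]

/-- A triple sum factorisation: `∑_{(m,q) ∈ S × T} ∑_i c_i f_i(m) g_i(q) = ∑_i c_i (∑_m f_i(m)) (∑_q g_i(q))`.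
[folklore] -/
theorem sum_product_sum_mul_mul_eq {α β : Type*} (S : Finset α) (T : Finset β) (I : Finset ℕ)
    (c : ℕ → ℝ) (f : ℕ → α → ℝ) (g : ℕ → β → ℝ) :
    ∑ w ∈ S ×ˢ T, ∑ i ∈ I, c i * f i w.1 * g i w.2 =
      ∑ i ∈ I, c i * (∑ m ∈ S, f i m) * ∑ q ∈ T, g i q := by
  rw [Finset.sum_comm]
  refine Finset.sum_congr rfl fun i _ => ?_
  rw [Finset.sum_product, mul_assoc, Finset.sum_mul_sum, Finset.mul_sum]
  refine Finset.sum_congr rfl fun m _ => ?_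
  rw [Finset.mul_sum]
  exact Finset.sum_congr rfl fun q _ => by ring

/-- **The non-coprime pairs.** In `∑_{dm ≤ N, (d,m) > 1} g♯(dm) Λ(d) Λ_j(m)` only prime powers
`d = p^a` with `p ∣ m` contribute; writing `m = p^b m'` (`b ≥ 1`, `p ∤ m'`) one has
`g♯(dm) = g♯(p^{a+b}) g♯(m')`, `Λ(d) = log p` and `Λ_j(m) = ∑_i (j choose i) Λ_i(p^b) Λ_{j−i}(m')`
(the rule at coprime arguments), and `(d, m) ↦ (m', p, a, b)` is injective; hence the sum is at
most `∑_i (j choose i) (∑_{m' ≤ N} Λ_{j−i}(m') g♯(m')) · ∑_{p ≤ N} ∑_{a,b ≥ 1} log p Λ_i(p^b) g♯(p^{a+b})`.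
This is the passage `m = δ h u`, `h ∣ δ^∞`, `(u, δ) = 1` of the proof of
[FriedlanderIwaniecPisa1978] Lemma 13. [cite: FriedlanderIwaniecPisa1978, Lemma 13 (proof, p. 740)] -/
theorem sum_noncoprime_pairs_le (A : SieveSequence) (hg0 : ∀ d : ℕ, 1 ≤ d → 0 ≤ A.density d)
    (hg1 : ∀ p : ℕ, p.Prime → A.density p < 1) (j N : ℕ) :
    ∑ x ∈ ((Ioc 0 N ×ˢ Ioc 0 N).filter (fun x : ℕ × ℕ => x.1 * x.2 ≤ N)).filter
        (fun x : ℕ × ℕ => ¬ x.1.Coprime x.2),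
        gsharp A (x.1 * x.2) * (Λ x.1 * generalizedVonMangoldt j x.2) ≤
      ∑ i ∈ range (j + 1), (j.choose i : ℝ) *
        (∑ m ∈ Ioc 0 N, generalizedVonMangoldt (j - i) m * gsharp A m) *
        ∑ p ∈ (Ioc 0 N).filter Nat.Prime, ∑ ab ∈ range N ×ˢ range N,
          Real.log p * generalizedVonMangoldt i (p ^ (ab.2 + 1)) *
            gsharp A (p ^ (ab.1 + ab.2 + 2)) := by
  classical
  have hgs : ∀ n, 0 ≤ gsharp A n := gsharp_nonneg hg0 hg1
  set S := ((Ioc 0 N ×ˢ Ioc 0 N).filter (fun x : ℕ × ℕ => x.1 * x.2 ≤ N)).filter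
    (fun x : ℕ × ℕ => ¬ x.1.Coprime x.2) with hS
  set G : ℕ × ℕ → ℝ := fun x => gsharp A (x.1 * x.2) * (Λ x.1 * generalizedVonMangoldt j x.2)
    with hG
  -- only prime powers `d` contribute
  set S' := S.filter (fun x : ℕ × ℕ => IsPrimePow x.1) with hS'
  have hstep0 : ∑ x ∈ S, G x = ∑ x ∈ S', G x := by
    rw [hS', ← Finset.sum_filter_add_sum_filter_not S (fun x : ℕ × ℕ => IsPrimePow x.1)]
    have hzero : ∑ x ∈ S.filter (fun x : ℕ × ℕ => ¬ IsPrimePow x.1), G x = 0 :=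
      Finset.sum_eq_zero fun x hx => by
        simp only [hG]
        rw [ArithmeticFunction.vonMangoldt_eq_zero_iff.mpr (Finset.mem_filter.mp hx).2, zero_mul,
          mul_zero]
    rw [hzero, add_zero]
  -- the reparametrisation `(d, m) ↦ (m', p, a - 1, b - 1)`
  set rho : ℕ × ℕ → ℕ × (ℕ × (ℕ × ℕ)) := fun x =>
    (x.2 / x.1.minFac ^ x.2.factorization x.1.minFac,
      (x.1.minFac, (x.1.factorization x.1.minFac - 1, x.2.factorization x.1.minFac - 1))) with hrho
  set Tg : Finset (ℕ × (ℕ × (ℕ × ℕ))) :=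
    Ioc 0 N ×ˢ (((Ioc 0 N).filter Nat.Prime) ×ˢ (range N ×ˢ range N)) with hTg
  set G' : ℕ × (ℕ × (ℕ × ℕ)) → ℝ := fun w =>
    ∑ i ∈ range (j + 1), (j.choose i : ℝ) *
      (generalizedVonMangoldt (j - i) w.1 * gsharp A w.1) *
      (Real.log w.2.1 * generalizedVonMangoldt i (w.2.1 ^ (w.2.2.2 + 1)) *
        gsharp A (w.2.1 ^ (w.2.2.1 + w.2.2.2 + 2))) with hG'
  -- the structure of an element of `S'`
  have hstruct : ∀ x ∈ S', x.1.minFac.Prime ∧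
      x.1.minFac ^ x.1.factorization x.1.minFac = x.1 ∧
      1 ≤ x.1.factorization x.1.minFac ∧ 1 ≤ x.2.factorization x.1.minFac ∧
      x.1.minFac ^ x.2.factorization x.1.minFac * (x.2 / x.1.minFac ^ x.2.factorization x.1.minFac)
        = x.2 ∧
      x.1.minFac.Coprime (x.2 / x.1.minFac ^ x.2.factorization x.1.minFac) ∧
      (0 < x.1 ∧ x.1 ≤ N) ∧ (0 < x.2 ∧ x.2 ≤ N) ∧
      x.1.factorization x.1.minFac < x.1 ∧ x.2.factorization x.1.minFac < x.2 := by
    intro x hx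
    rw [hS', Finset.mem_filter, hS, Finset.mem_filter, Finset.mem_filter, Finset.mem_product,
      Finset.mem_Ioc, Finset.mem_Ioc] at hx
    obtain ⟨⟨⟨⟨hx1, hx2⟩, -⟩, hncop⟩, hpp⟩ := hx
    have hx1' : x.1 ≠ 0 := hx1.1.ne'
    have hx2' : x.2 ≠ 0 := hx2.1.ne'
    have hne1 : x.1 ≠ 1 := hpp.ne_one
    have hp : x.1.minFac.Prime := Nat.minFac_prime hne1
    have hpow : x.1.minFac ^ x.1.factorization x.1.minFac = x.1 := hpp.minFac_pow_factorization_eq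
    have ha : 1 ≤ x.1.factorization x.1.minFac := by
      have := Nat.factorization_minFac_ne_zero (show 1 < x.1 by omega)
      omega
    have hpdvd : x.1.minFac ∣ x.2 := by
      by_contra hnd
      apply hncop
      rw [← hpow]
      exact Nat.Coprime.pow_left _ ((Nat.Prime.coprime_iff_not_dvd hp).mpr hnd)
    have hb : 1 ≤ x.2.factorization x.1.minFac := Nat.Prime.factorization_pos_of_dvd hp hx2' hpdvd
    exact ⟨hp, hpow, ha, hb, Nat.ordProj_mul_ordCompl_eq_self x.2 x.1.minFac,
      Nat.coprime_ordCompl hp hx2', hx1, hx2, Nat.factorization_lt _ hx1', Nat.factorization_lt _ hx2'⟩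
  -- `rho` maps `S'` into `Tg`
  have hmaps : ∀ x ∈ S', rho x ∈ Tg := by
    intro x hx
    obtain ⟨hp, hpow, ha, hb, hm', -, hx1, hx2, halt, hblt⟩ := hstruct x hx
    have hx2' : x.2 ≠ 0 := hx2.1.ne'
    simp only [hrho, hTg, Finset.mem_product, Finset.mem_Ioc, Finset.mem_filter, Finset.mem_range]
    refine ⟨⟨Nat.ordCompl_pos _ hx2', (Nat.div_le_self _ _).trans hx2.2⟩,
      ⟨⟨hp.pos, (Nat.minFac_le hx1.1).trans hx1.2⟩, hp⟩, ?_, ?_⟩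
    · omega
    · omega
  -- `G = G' ∘ rho` on `S'`
  have hGG' : ∀ x ∈ S', G x = G' (rho x) := by
    intro x hx
    obtain ⟨hp, hpow, ha, hb, hm', hcop, hx1, hx2, -, -⟩ := hstruct x hx
    set p := x.1.minFac with hpdef
    set a := x.1.factorization p with hadef
    set b := x.2.factorization p with hbdef
    set m' := x.2 / p ^ b with hm'def
    have hab : a - 1 + (b - 1) + 2 = a + b := by omega
    have hb1 : b - 1 + 1 = b := by omega
    have hrx : rho x = (m', (p, (a - 1, b - 1))) := rfl
    rw [hrx]
    simp only [hG, hG']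
    rw [hab, hb1]
    -- the three identities
    have hprod : x.1 * x.2 = p ^ (a + b) * m' := by
      rw [← hpow, ← hm', pow_add]; ring
    have hgsharp : gsharp A (x.1 * x.2) = gsharp A (p ^ (a + b)) * gsharp A m' := by
      rw [hprod, gsharp_mul (Nat.Coprime.pow_left _ hcop)]
    have hΛ : Λ x.1 = Real.log p := by
      rw [← hpow, ArithmeticFunction.vonMangoldt_apply_pow (by omega),
        ArithmeticFunction.vonMangoldt_apply_prime hp]
    have hΛj : generalizedVonMangoldt j x.2 = ∑ i ∈ range (j + 1), (j.choose i : ℝ) *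
        (generalizedVonMangoldt i (p ^ b) * generalizedVonMangoldt (j - i) m') := by
      rw [← hm', generalizedVonMangoldt_mul_of_coprime' (Nat.Coprime.pow_left _ hcop)]
    rw [hgsharp, hΛ, hΛj, Finset.mul_sum, Finset.mul_sum]
    exact Finset.sum_congr rfl fun i _ => by ring
  -- `rho` is injective on `S'`
  have hinj : Set.InjOn rho ↑S' := by
    intro x hx x' hx' h
    obtain ⟨-, hpow, ha, hb, hm', -, -, -, -, -⟩ := hstruct x hx
    obtain ⟨-, hpow', ha', hb', hm'', -, -, -, -, -⟩ := hstruct x' hx'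
    simp only [hrho, Prod.mk.injEq] at h
    obtain ⟨hm, hp, hae, hbe⟩ := h
    have hp' : x.1.minFac = x'.1.minFac := hp
    have hae' : x.1.factorization x.1.minFac = x'.1.factorization x'.1.minFac := by omega
    have hbe' : x.2.factorization x.1.minFac = x'.2.factorization x'.1.minFac := by omega
    have h1 : x.1 = x'.1 := by rw [← hpow, ← hpow', hae', hp']
    have h2 : x.2 = x'.2 := by rw [← hm', ← hm'', hm, hbe', hp']
    exact Prod.ext h1 h2
  -- `G' ≥ 0` on `Tg`
  have hG'0 : ∀ w ∈ Tg, 0 ≤ G' w := by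
    intro w hw
    simp only [hTg, Finset.mem_product, Finset.mem_filter] at hw
    have hp : w.2.1.Prime := hw.2.1.2
    have hlog : 0 ≤ Real.log w.2.1 := Real.log_nonneg (by exact_mod_cast hp.one_lt.le)
    simp only [hG']
    refine Finset.sum_nonneg fun i _ => ?_
    have := generalizedVonMangoldt_nonneg (j - i) w.1
    have := generalizedVonMangoldt_nonneg i (w.2.1 ^ (w.2.2.2 + 1))
    have := hgs w.1
    have := hgs (w.2.1 ^ (w.2.2.1 + w.2.2.2 + 2))
    positivity
  -- conclusion
  calc ∑ x ∈ S, G x = ∑ x ∈ S', G x := hstep0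
    _ = ∑ x ∈ S', G' (rho x) := Finset.sum_congr rfl hGG'
    _ ≤ ∑ w ∈ Tg, G' w := sum_comp_le_of_injOn S' Tg rho hinj hmaps G' hG'0
    _ = ∑ i ∈ range (j + 1), (j.choose i : ℝ) *
          (∑ m ∈ Ioc 0 N, generalizedVonMangoldt (j - i) m * gsharp A m) *
          ∑ q ∈ ((Ioc 0 N).filter Nat.Prime) ×ˢ (range N ×ˢ range N),
            Real.log q.1 * generalizedVonMangoldt i (q.1 ^ (q.2.2 + 1)) *
              gsharp A (q.1 ^ (q.2.1 + q.2.2 + 2)) :=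
        sum_product_sum_mul_mul_eq (Ioc 0 N) (((Ioc 0 N).filter Nat.Prime) ×ˢ (range N ×ˢ range N))
          (range (j + 1)) (fun i => (j.choose i : ℝ))
          (fun i m => generalizedVonMangoldt (j - i) m * gsharp A m)
          (fun i q => Real.log q.1 * generalizedVonMangoldt i (q.1 ^ (q.2.2 + 1)) *
            gsharp A (q.1 ^ (q.2.1 + q.2.2 + 2)))
    _ = _ := by
        refine Finset.sum_congr rfl fun i _ => ?_
        rw [Finset.sum_product]

/-- The weighted form of `sum_Ioc_sum_divisorsAntidiagonal_eq`: a weight `h(n)` becomes `h(dm)`.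
[folklore] -/
theorem sum_Ioc_sum_divisorsAntidiagonal_mul_eq (N : ℕ) (h : ℕ → ℝ) (F : ℕ × ℕ → ℝ) :
    ∑ n ∈ Ioc 0 N, ∑ x ∈ n.divisorsAntidiagonal, h n * F x =
      ∑ x ∈ (Ioc 0 N ×ˢ Ioc 0 N).filter (fun x : ℕ × ℕ => x.1 * x.2 ≤ N),
        h (x.1 * x.2) * F x := by
  rw [← sum_Ioc_sum_divisorsAntidiagonal_eq N (fun x => h (x.1 * x.2) * F x)]
  refine Finset.sum_congr rfl fun n _ => Finset.sum_congr rfl fun x hx => ?_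
  rw [(Nat.mem_divisorsAntidiagonal.mp hx).1]

/-- **One step of the recursion for `G_j(y) = ∑_{d ≤ y} Λ_j(d) g♯(d)`**:
`G_{j+1}(y) ≤ (log y + C₀) G_j(y) + ∑_{i ≤ j} (j choose i) G_{j−i}(y) E_i(y)`, where `C₀` is the
constant of the Mertens bound `∑_{d ≤ t} Λ(d) g♯(d) ≤ log t + C₀` (`sum_vonMangoldt_mul_gsharp_le`)
and `E_i(y) = ∑_{p ≤ y} ∑_{a,b ≥ 1} log p Λ_i(p^b) g♯(p^{a+b})` are the weights of the non-coprime
pairs (`sum_primePowPair_weight_le`). The coprime pairs give exactly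
`∑_m Λ_j(m) g♯(m) (log m + log (y/m) + C₀) = (log y + C₀) G_j(y)`, as in the proof of
[FriedlanderIwaniecPisa1978] Lemma 2. [cite: FriedlanderIwaniecPisa1978, Lemmata 2 and 13 (proofs)] -/
theorem lamG_succ_le (A : SieveSequence) (hg0 : ∀ d : ℕ, 1 ≤ d → 0 ≤ A.density d)
    (hg1 : ∀ p : ℕ, p.Prime → A.density p < 1) {C₀ : ℝ}
    (hC₀ : ∀ t : ℝ, 1 ≤ t → ∑ d ∈ Ioc 0 ⌊t⌋₊, Λ d * gsharp A d ≤ Real.log t + C₀)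
    (j : ℕ) {y : ℝ} (hy : 1 ≤ y) :
    lamG A (j + 1) y ≤ (Real.log y + C₀) * lamG A j y +
      ∑ i ∈ range (j + 1), (j.choose i : ℝ) * lamG A (j - i) y *
        ∑ p ∈ (Ioc 0 ⌊y⌋₊).filter Nat.Prime, ∑ ab ∈ range ⌊y⌋₊ ×ˢ range ⌊y⌋₊,
          Real.log p * generalizedVonMangoldt i (p ^ (ab.2 + 1)) *
            gsharp A (p ^ (ab.1 + ab.2 + 2)) := by
  classical
  have hgs : ∀ n, 0 ≤ gsharp A n := gsharp_nonneg hg0 hg1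
  have hy0 : 0 < y := by linarith
  set N := ⌊y⌋₊ with hN
  set T := (Ioc 0 N ×ˢ Ioc 0 N).filter (fun x : ℕ × ℕ => x.1 * x.2 ≤ N) with hT
  set G : ℕ × ℕ → ℝ := fun x => gsharp A (x.1 * x.2) * (Λ x.1 * generalizedVonMangoldt j x.2)
    with hG
  have hG0 : ∀ x, 0 ≤ G x := fun x => mul_nonneg (hgs _)
    (mul_nonneg ArithmeticFunction.vonMangoldt_nonneg (generalizedVonMangoldt_nonneg _ _))
  -- the recursion
  have hrec : lamG A (j + 1) y =
      ∑ n ∈ Ioc 0 N, generalizedVonMangoldt j n * gsharp A n * Real.log n + ∑ x ∈ T, G x := by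
    rw [lamG, sum_generalizedVonMangoldt_succ_mul_eq, ← hN, hT,
      ← sum_Ioc_sum_divisorsAntidiagonal_mul_eq N (gsharp A)
        (fun x => Λ x.1 * generalizedVonMangoldt j x.2)]
  -- coprime pairs
  have hcop : ∑ x ∈ T.filter (fun x : ℕ × ℕ => x.1.Coprime x.2), G x ≤
      ∑ m ∈ Ioc 0 N, generalizedVonMangoldt j m * gsharp A m * (Real.log (y / m) + C₀) := by
    have hfilt : T.filter (fun x : ℕ × ℕ => x.1.Coprime x.2) =
        T.filter (fun x : ℕ × ℕ => x.1.Coprime x.2 ∧ x.2 ∈ Ioc 0 N ∧ True) := by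
      refine Finset.filter_congr fun x hx => ?_
      rw [hT, Finset.mem_filter, Finset.mem_product] at hx
      exact ⟨fun h => ⟨h, hx.1.2, trivial⟩, fun h => h.1⟩
    rw [hfilt]
    refine (sum_coprime_pairs_le A hg0 hg1 j N (Ioc 0 N) subset_rfl (fun _ => True)).trans ?_
    refine Finset.sum_le_sum fun m hm => ?_
    obtain ⟨hm0, hmN⟩ := Finset.mem_Ioc.mp hm
    have hm0' : (0 : ℝ) < m := by exact_mod_cast hm0
    have hmy : (m : ℝ) ≤ y := le_trans (by exact_mod_cast hmN) (Nat.floor_le hy0.le)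
    have hym : 1 ≤ y / m := by rwa [le_div_iff₀ hm0', one_mul]
    refine mul_le_mul_of_nonneg_left ?_ (mul_nonneg (generalizedVonMangoldt_nonneg _ _) (hgs _))
    rw [Finset.filter_true_of_mem (fun _ _ => trivial)]
    have h := hC₀ (y / m) hym
    rwa [Nat.floor_div_natCast, ← hN] at h
  -- the main combination `log m + log (y/m) = log y`
  have hmainA : ∑ n ∈ Ioc 0 N, generalizedVonMangoldt j n * gsharp A n * Real.log n +
      ∑ m ∈ Ioc 0 N, generalizedVonMangoldt j m * gsharp A m * (Real.log (y / m) + C₀) =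
      (Real.log y + C₀) * lamG A j y := by
    rw [lamG, ← hN, ← Finset.sum_add_distrib, Finset.mul_sum]
    refine Finset.sum_congr rfl fun m hm => ?_
    have hm0 : (0 : ℝ) < m := by exact_mod_cast (Finset.mem_Ioc.mp hm).1
    rw [Real.log_div hy0.ne' hm0.ne']
    ring
  -- assembly
  have hsplit := (Finset.sum_filter_add_sum_filter_not T (fun x : ℕ × ℕ => x.1.Coprime x.2) G).symm
  have hnc := sum_noncoprime_pairs_le A hg0 hg1 j N
  rw [hrec, hsplit]
  calc ∑ n ∈ Ioc 0 N, generalizedVonMangoldt j n * gsharp A n * Real.log n +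
        (∑ x ∈ T.filter (fun x : ℕ × ℕ => x.1.Coprime x.2), G x +
          ∑ x ∈ T.filter (fun x : ℕ × ℕ => ¬ x.1.Coprime x.2), G x)
      ≤ ∑ n ∈ Ioc 0 N, generalizedVonMangoldt j n * gsharp A n * Real.log n +
        (∑ m ∈ Ioc 0 N, generalizedVonMangoldt j m * gsharp A m * (Real.log (y / m) + C₀) +
          ∑ i ∈ range (j + 1), (j.choose i : ℝ) *
            (∑ m ∈ Ioc 0 N, generalizedVonMangoldt (j - i) m * gsharp A m) *
            ∑ p ∈ (Ioc 0 N).filter Nat.Prime, ∑ ab ∈ range N ×ˢ range N,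
              Real.log p * generalizedVonMangoldt i (p ^ (ab.2 + 1)) *
                gsharp A (p ^ (ab.1 + ab.2 + 2))) := by
        gcongr
    _ = _ := by rw [← add_assoc, hmainA]; rfl

/-- If `d m > 1` has least prime factor `< z` while `m` does not (i.e. `m = 1` or
`minFac m ≥ z`), then `d > 1` and `minFac d < z`. [folklore] -/
theorem minFac_lt_of_mul {d m : ℕ} {z : ℝ} (hd : 0 < d) (hm : 0 < m) (h1 : 1 < d * m)
    (hz : ((d * m).minFac : ℝ) < z) (hnot : ¬ (1 < m ∧ (m.minFac : ℝ) < z)) :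
    1 < d ∧ (d.minFac : ℝ) < z := by
  set q := (d * m).minFac with hq
  have hqp : q.Prime := Nat.minFac_prime h1.ne'
  have hqdvd : q ∣ d * m := Nat.minFac_dvd _
  rcases (Nat.Prime.dvd_mul hqp).mp hqdvd with hqd | hqm
  · have hqle : d.minFac ≤ q := Nat.minFac_le_of_dvd hqp.two_le hqd
    have hd1 : 1 < d := lt_of_lt_of_le hqp.one_lt (Nat.le_of_dvd hd hqd)
    exact ⟨hd1, lt_of_le_of_lt (by exact_mod_cast hqle) hz⟩
  · exfalso
    refine hnot ⟨lt_of_lt_of_le hqp.one_lt (Nat.le_of_dvd hm hqm), ?_⟩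
    have hqle : m.minFac ≤ q := Nat.minFac_le_of_dvd hqp.two_le hqm
    exact lt_of_le_of_lt (by exact_mod_cast hqle) hz

/-- **One step of the recursion for `G_j(y; z) = ∑_{1 < d ≤ y, minFac d < z} Λ_j(d) g♯(d)`**:
`G_{j+1}(y; z) ≤ (log y + C₀) G_j(y; z) + (log z + C₀') G_j(y) + ∑_{i ≤ j} (j choose i) G_{j−i}(y) E_i(y)`:
in `Λ_{j+1}(n) = Λ_j(n) log n + ∑_{dm = n} Λ(d) Λ_j(m)` with `minFac n < z`, a coprime pair
`(d, m)` has either `minFac m < z` (giving, with the first term, `(log y + C₀) G_j(y; z)`) or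
`d = p^a` with `p < z` (giving `(log z + C₀') G_j(y)` by the `z`-restricted Mertens bound
`sum_vonMangoldt_mul_gsharp_minFac_le`), and the non-coprime pairs are bounded as in
`lamG_succ_le`. [cite: FriedlanderIwaniecPisa1978, Lemmata 2 and 13 (proofs)] -/
theorem lamGz_succ_le (A : SieveSequence) (hg0 : ∀ d : ℕ, 1 ≤ d → 0 ≤ A.density d)
    (hg1 : ∀ p : ℕ, p.Prime → A.density p < 1) {C₀ C₀' : ℝ}
    (hC₀ : ∀ t : ℝ, 1 ≤ t → ∑ d ∈ Ioc 0 ⌊t⌋₊, Λ d * gsharp A d ≤ Real.log t + C₀)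
    (hC₀' : ∀ t z : ℝ, 0 ≤ t → 2 ≤ z →
      ∑ d ∈ (Ioc 0 ⌊t⌋₊).filter (fun d : ℕ => (d.minFac : ℝ) < z), Λ d * gsharp A d ≤
        Real.log z + C₀')
    (j : ℕ) {y z : ℝ} (hy : 1 ≤ y) (hz : 2 ≤ z) :
    lamGz A (j + 1) y z ≤ (Real.log y + C₀) * lamGz A j y z + (Real.log z + C₀') * lamG A j y +
      ∑ i ∈ range (j + 1), (j.choose i : ℝ) * lamG A (j - i) y *
        ∑ p ∈ (Ioc 0 ⌊y⌋₊).filter Nat.Prime, ∑ ab ∈ range ⌊y⌋₊ ×ˢ range ⌊y⌋₊,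
          Real.log p * generalizedVonMangoldt i (p ^ (ab.2 + 1)) *
            gsharp A (p ^ (ab.1 + ab.2 + 2)) := by
  classical
  have hgs : ∀ n, 0 ≤ gsharp A n := gsharp_nonneg hg0 hg1
  have hy0 : 0 < y := by linarith
  set N := ⌊y⌋₊ with hN
  set T := (Ioc 0 N ×ˢ Ioc 0 N).filter (fun x : ℕ × ℕ => x.1 * x.2 ≤ N) with hT
  set G : ℕ × ℕ → ℝ := fun x => gsharp A (x.1 * x.2) * (Λ x.1 * generalizedVonMangoldt j x.2)
    with hG
  have hG0 : ∀ x, 0 ≤ G x := fun x => mul_nonneg (hgs _)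
    (mul_nonneg ArithmeticFunction.vonMangoldt_nonneg (generalizedVonMangoldt_nonneg _ _))
  set Pz : ℕ → Prop := fun n => 1 < n ∧ (n.minFac : ℝ) < z with hPz
  set Mz := (Ioc 0 N).filter (fun m : ℕ => Pz m) with hMz
  set Q : ℕ → Prop := fun d => (d.minFac : ℝ) < z with hQ
  -- the recursion, with the indicator of `Pz` moved onto the pairs
  have hrec : lamGz A (j + 1) y z =
      ∑ n ∈ Mz, generalizedVonMangoldt j n * gsharp A n * Real.log n +
        ∑ x ∈ T.filter (fun x : ℕ × ℕ => Pz (x.1 * x.2)), G x := by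
    have h0 : lamGz A (j + 1) y z = ∑ n ∈ Mz, generalizedVonMangoldt (j + 1) n * gsharp A n := rfl
    rw [h0, sum_generalizedVonMangoldt_succ_mul_eq]
    congr 1
    rw [hMz, Finset.sum_filter, hT, Finset.sum_filter,
      ← sum_Ioc_sum_divisorsAntidiagonal_eq N (fun x => if Pz (x.1 * x.2) then G x else 0)]
    refine Finset.sum_congr rfl fun n _ => ?_
    split_ifs with hn
    · refine Finset.sum_congr rfl fun x hx => ?_
      simp only [hG]
      rw [(Nat.mem_divisorsAntidiagonal.mp hx).1, if_pos hn]
    · symm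
      refine Finset.sum_eq_zero fun x hx => ?_
      rw [(Nat.mem_divisorsAntidiagonal.mp hx).1, if_neg hn]
  -- dissection of the pairs
  set A₁ := T.filter (fun x : ℕ × ℕ => ¬ x.1.Coprime x.2) with hA₁
  set A₂ := T.filter (fun x : ℕ × ℕ => x.1.Coprime x.2 ∧ x.2 ∈ Mz ∧ True) with hA₂
  set A₃ := T.filter (fun x : ℕ × ℕ => x.1.Coprime x.2 ∧ x.2 ∈ Ioc 0 N ∧ Q x.1) with hA₃
  have hdiss : ∑ x ∈ T.filter (fun x : ℕ × ℕ => Pz (x.1 * x.2)), G x ≤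
      ∑ x ∈ A₁, G x + ∑ x ∈ A₂, G x + ∑ x ∈ A₃, G x := by
    set TP := T.filter (fun x : ℕ × ℕ => Pz (x.1 * x.2)) with hTP
    rw [← Finset.sum_filter_add_sum_filter_not TP (fun x : ℕ × ℕ => ¬ x.1.Coprime x.2),
      ← Finset.sum_filter_add_sum_filter_not (TP.filter (fun x : ℕ × ℕ => ¬ ¬ x.1.Coprime x.2))
        (fun x : ℕ × ℕ => x.2 ∈ Mz), add_assoc]
    refine add_le_add ?_ (add_le_add ?_ ?_)
    · refine Finset.sum_le_sum_of_subset_of_nonneg (fun x hx => ?_) fun x _ _ => hG0 x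
      rw [Finset.mem_filter, hTP, Finset.mem_filter] at hx
      exact Finset.mem_filter.mpr ⟨hx.1.1, hx.2⟩
    · refine Finset.sum_le_sum_of_subset_of_nonneg (fun x hx => ?_) fun x _ _ => hG0 x
      rw [Finset.mem_filter, Finset.mem_filter, hTP, Finset.mem_filter] at hx
      exact Finset.mem_filter.mpr ⟨hx.1.1.1, not_not.mp hx.1.2, hx.2, trivial⟩
    · refine Finset.sum_le_sum_of_subset_of_nonneg (fun x hx => ?_) fun x _ _ => hG0 x
      rw [Finset.mem_filter, Finset.mem_filter, hTP, Finset.mem_filter] at hx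
      obtain ⟨⟨⟨hxT, hPx⟩, hcop⟩, hnot⟩ := hx
      have hxT' := hxT
      rw [hT, Finset.mem_filter, Finset.mem_product, Finset.mem_Ioc, Finset.mem_Ioc] at hxT'
      have hnot' : ¬ (1 < x.2 ∧ ((x.2).minFac : ℝ) < z) := fun h =>
        hnot (Finset.mem_filter.mpr ⟨Finset.mem_Ioc.mpr hxT'.1.2, h⟩)
      have hmf := minFac_lt_of_mul hxT'.1.1.1 hxT'.1.2.1 hPx.1 hPx.2 hnot'
      exact Finset.mem_filter.mpr ⟨hxT, not_not.mp hcop, Finset.mem_Ioc.mpr hxT'.1.2, hmf.2⟩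
  -- `A₂`: coprime pairs with `minFac m < z`
  have hA₂le : ∑ x ∈ A₂, G x ≤
      ∑ m ∈ Mz, generalizedVonMangoldt j m * gsharp A m * (Real.log (y / m) + C₀) := by
    refine (sum_coprime_pairs_le A hg0 hg1 j N Mz (Finset.filter_subset _ _) (fun _ => True)).trans ?_
    refine Finset.sum_le_sum fun m hm => ?_
    obtain ⟨hm0, hmN⟩ := Finset.mem_Ioc.mp (Finset.mem_filter.mp hm).1
    have hm0' : (0 : ℝ) < m := by exact_mod_cast hm0
    have hmy : (m : ℝ) ≤ y := le_trans (by exact_mod_cast hmN) (Nat.floor_le hy0.le)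
    have hym : 1 ≤ y / m := by rwa [le_div_iff₀ hm0', one_mul]
    refine mul_le_mul_of_nonneg_left ?_ (mul_nonneg (generalizedVonMangoldt_nonneg _ _) (hgs _))
    rw [Finset.filter_true_of_mem (fun _ _ => trivial)]
    have h := hC₀ (y / m) hym
    rwa [Nat.floor_div_natCast, ← hN] at h
  -- `A₃`: coprime pairs with `d = p^a`, `p < z`
  have hA₃le : ∑ x ∈ A₃, G x ≤ (Real.log z + C₀') * lamG A j y := by
    refine (sum_coprime_pairs_le A hg0 hg1 j N (Ioc 0 N) subset_rfl Q).trans ?_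
    rw [lamG, ← hN, Finset.mul_sum]
    refine Finset.sum_le_sum fun m hm => ?_
    obtain ⟨hm0, hmN⟩ := Finset.mem_Ioc.mp hm
    have h := hC₀' (y / m) z (div_nonneg hy0.le (Nat.cast_nonneg m)) hz
    rw [Nat.floor_div_natCast, ← hN] at h
    calc generalizedVonMangoldt j m * gsharp A m *
          ∑ d ∈ (Ioc 0 (N / m)).filter Q, Λ d * gsharp A d
        ≤ generalizedVonMangoldt j m * gsharp A m * (Real.log z + C₀') :=
          mul_le_mul_of_nonneg_left h (mul_nonneg (generalizedVonMangoldt_nonneg _ _) (hgs _))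
      _ = (Real.log z + C₀') * (generalizedVonMangoldt j m * gsharp A m) := by ring
  -- the main combination `log m + log (y/m) = log y` over `Mz`
  have hmainA : ∑ n ∈ Mz, generalizedVonMangoldt j n * gsharp A n * Real.log n +
      ∑ m ∈ Mz, generalizedVonMangoldt j m * gsharp A m * (Real.log (y / m) + C₀) =
      (Real.log y + C₀) * lamGz A j y z := by
    have h0 : lamGz A j y z = ∑ n ∈ Mz, generalizedVonMangoldt j n * gsharp A n := rfl
    rw [h0, ← Finset.sum_add_distrib, Finset.mul_sum]
    refine Finset.sum_congr rfl fun m hm => ?_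
    have hm0 : (0 : ℝ) < m := by exact_mod_cast (Finset.mem_Ioc.mp (Finset.mem_filter.mp hm).1).1
    rw [Real.log_div hy0.ne' hm0.ne']
    ring
  -- assembly
  have hnc := sum_noncoprime_pairs_le A hg0 hg1 j N
  have hlamG : ∀ i, lamG A (j - i) y = ∑ m ∈ Ioc 0 N, generalizedVonMangoldt (j - i) m * gsharp A m :=
    fun i => rfl
  simp only [hlamG]
  rw [hrec]
  linarith [hdiss, hA₂le, hA₃le, hmainA, hnc]

/-! ### The induction: uniform bounds for `G_j(y)` and `G_j(y; z)` -/

/-- `(i choose t) · t! ≤ i^t` (the falling factorial). [folklore] -/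
theorem choose_mul_factorial_le_pow (i t : ℕ) : ((i.choose t : ℕ) : ℝ) * t ! ≤ (i : ℝ) ^ t := by
  have h : i.choose t * t ! ≤ i ^ t := by
    rw [mul_comm, ← Nat.descFactorial_eq_factorial_mul_choose]
    exact Nat.descFactorial_le_pow i t
  exact_mod_cast h

/-- **The error sum of one step is `≤ 2K L^i Θ^i`** when `16 i ≤ L`: with `G_t ≤ L^t Θ^t`
(`t ≤ i`, `Θ ≥ 1`) and `E_t ≤ K 8^t t!`,
`∑_{t ≤ i} (i choose t) G_{i−t} E_t ≤ K Θ^i L^i ∑_t (8i/L)^t ≤ 2 K L^i Θ^i`. [folklore] -/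
theorem step_error_sum_le {K L Θ : ℝ} (hK : 0 ≤ K) (hL : 0 < L) (hΘ : 1 ≤ Θ) (i : ℕ)
    (hi : 16 * (i : ℝ) ≤ L) (G E : ℕ → ℝ) (hG : ∀ t, t ≤ i → G t ≤ L ^ t * Θ ^ t)
    (hE : ∀ t, E t ≤ K * (8 : ℝ) ^ t * t !) (hE0 : ∀ t, 0 ≤ E t) :
    ∑ t ∈ range (i + 1), (i.choose t : ℝ) * G (i - t) * E t ≤ 2 * K * L ^ i * Θ ^ i := by
  have hΘ0 : 0 < Θ := by linarith
  have hratio : 8 * (i : ℝ) / L ≤ 1 / 2 := by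
    rw [div_le_iff₀ hL]; linarith
  have hratio0 : 0 ≤ 8 * (i : ℝ) / L := by positivity
  have hterm : ∀ t ∈ range (i + 1), (i.choose t : ℝ) * G (i - t) * E t ≤
      K * L ^ i * Θ ^ i * (1 / 2 : ℝ) ^ t := by
    intro t ht
    have hti : t ≤ i := Nat.lt_succ_iff.mp (Finset.mem_range.mp ht)
    have hGt := hG (i - t) (Nat.sub_le i t)
    have hΘpow : Θ ^ (i - t) ≤ Θ ^ i := pow_le_pow_right₀ hΘ (Nat.sub_le i t)
    have hLsplit : L ^ (i - t) * L ^ t = L ^ i := by rw [← pow_add, Nat.sub_add_cancel hti]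
    have hchoose := choose_mul_factorial_le_pow i t
    have hpow : (8 * (i : ℝ) / L) ^ t ≤ (1 / 2 : ℝ) ^ t := pow_le_pow_left₀ hratio0 hratio t
    -- `G (i - t) ≤ L^{i-t} Θ^{i-t}` may be negative a priori only if `G` is; bound via `hGt`
    calc (i.choose t : ℝ) * G (i - t) * E t
        ≤ (i.choose t : ℝ) * (L ^ (i - t) * Θ ^ (i - t)) * (K * (8 : ℝ) ^ t * t !) := by
          refine mul_le_mul (mul_le_mul_of_nonneg_left hGt (Nat.cast_nonneg _)) (hE t) (hE0 t) ?_
          exact mul_nonneg (Nat.cast_nonneg _) (by positivity)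
      _ = K * Θ ^ (i - t) * (((i.choose t : ℕ) : ℝ) * t !) * ((8 : ℝ) ^ t * L ^ (i - t)) := by ring
      _ ≤ K * Θ ^ i * ((i : ℝ) ^ t) * ((8 : ℝ) ^ t * L ^ (i - t)) := by
          gcongr
      _ = K * Θ ^ i * L ^ i * ((8 * (i : ℝ) / L) ^ t) := by
          rw [← hLsplit, div_pow, mul_pow]
          field_simp
      _ ≤ K * Θ ^ i * L ^ i * (1 / 2 : ℝ) ^ t := by gcongr
      _ = K * L ^ i * Θ ^ i * (1 / 2 : ℝ) ^ t := by ring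
  have hgeom : ∑ t ∈ range (i + 1), (1 / 2 : ℝ) ^ t ≤ 2 := by
    have h := geom_sum_Ico_le_of_lt_one (x := (1 / 2 : ℝ)) (m := 0) (n := i + 1) (by norm_num)
      (by norm_num)
    rw [← Finset.range_eq_Ico, pow_zero] at h
    exact h.trans (by norm_num)
  calc ∑ t ∈ range (i + 1), (i.choose t : ℝ) * G (i - t) * E t
      ≤ ∑ t ∈ range (i + 1), K * L ^ i * Θ ^ i * (1 / 2 : ℝ) ^ t := Finset.sum_le_sum hterm
    _ = K * L ^ i * Θ ^ i * ∑ t ∈ range (i + 1), (1 / 2 : ℝ) ^ t := by rw [Finset.mul_sum]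
    _ ≤ K * L ^ i * Θ ^ i * 2 := mul_le_mul_of_nonneg_left hgeom (by positivity)
    _ = 2 * K * L ^ i * Θ ^ i := by ring

/-- **The smooth-part sums, uniformly in the rank** (the `K = ℚ`, scalar, `g♯`-weighted form of
[FriedlanderIwaniecPisa1978] Lemmata 13–15): under (A₁), (A₅), `g ≥ 0` there is `C ≥ 1` such that
for all `y ≥ 1`, `z ≥ 2` and all `j` with `16 j ≤ log y + C`,
`G_j(y) = ∑_{d ≤ y} Λ_j(d) g♯(d) ≤ C (log y + C)^j` and
`G_j(y; z) = ∑_{1 < d ≤ y, minFac d < z} Λ_j(d) g♯(d) ≤ C j (log y + C)^{j−1} (log z + C)`.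
Proof: induction on `j` with `lamG_succ_le`, `lamGz_succ_le`, `step_error_sum_le`, in the form
`G_j ≤ L'^j Θ^j`, `G_j(·; z) ≤ j L'^{j−1} Θ^j (log z + C₀' + 2K)` with `L' = log y + C`,
`Θ = 1 + 2K/L'`, `Θ^j ≤ e^{2Kj/L'} ≤ e^{K/8}`.
[cite: FriedlanderIwaniecPisa1978, Lemmata 13-15 (K = Q, scalar)] -/
theorem lamG_lamGz_le_uniform (A : SieveSequence) (h1 : A.BombieriA1) (h5 : A.BombieriA5)
    (hg0 : ∀ d : ℕ, 1 ≤ d → 0 ≤ A.density d) :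
    ∃ C : ℝ, 1 ≤ C ∧ ∀ y z : ℝ, 1 ≤ y → 2 ≤ z → ∀ j : ℕ, 16 * (j : ℝ) ≤ Real.log y + C →
      lamG A j y ≤ C * (Real.log y + C) ^ j ∧
        lamGz A j y z ≤ C * j * (Real.log y + C) ^ (j - 1) * (Real.log z + C) := by
  have hg1 : ∀ p : ℕ, p.Prime → A.density p < 1 := fun p hp => h1.2 p hp.one_lt
  have hgs : ∀ n, 0 ≤ gsharp A n := gsharp_nonneg hg0 hg1
  obtain ⟨C₀, hC₀0, hC₀⟩ := sum_vonMangoldt_mul_gsharp_le A h1 h5 hg0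
  obtain ⟨C₀', hC₀'0, hC₀'⟩ := sum_vonMangoldt_mul_gsharp_minFac_le A h1 h5 hg0
  obtain ⟨K, hK0, hK⟩ := sum_primePowPair_weight_le A h1 hg0
  set C : ℝ := max (max (C₀ + 1) (C₀' + 2 * K)) (Real.exp (K / 8)) with hC
  have hC1 : C₀ + 1 ≤ C := (le_max_left _ _).trans (le_max_left _ _)
  have hC2 : C₀' + 2 * K ≤ C := (le_max_right _ _).trans (le_max_left _ _)
  have hC3 : Real.exp (K / 8) ≤ C := le_max_right _ _
  have hCge1 : 1 ≤ C := by linarith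
  refine ⟨C, hCge1, fun y z hy hz j hj => ?_⟩
  have hy0 : 0 < y := by linarith
  set L : ℝ := Real.log y + C with hL
  have hlogy : 0 ≤ Real.log y := Real.log_nonneg hy
  have hL1 : 1 ≤ L := by linarith
  have hL0 : 0 < L := by linarith
  have hlogz : 0 ≤ Real.log z := Real.log_nonneg (by linarith)
  -- the Mertens bound with `C` in place of `C₀`
  have hC₀L : ∀ t : ℝ, 1 ≤ t → ∑ d ∈ Ioc 0 ⌊t⌋₊, Λ d * gsharp A d ≤ Real.log t + C :=
    fun t ht => (hC₀ t ht).trans (by linarith)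
  set Θ : ℝ := 1 + 2 * K / L with hΘ
  have hΘ1 : 1 ≤ Θ := by rw [hΘ]; linarith [div_nonneg (by positivity : 0 ≤ 2 * K) hL0.le]
  have hΘ0 : 0 < Θ := by linarith
  set W : ℝ := Real.log z + C₀' + 2 * K with hW
  have hW0 : 0 ≤ W := by positivity
  -- nonnegativity of the sums
  have hG0 : ∀ t, 0 ≤ lamG A t y := fun t =>
    Finset.sum_nonneg fun d _ => mul_nonneg (generalizedVonMangoldt_nonneg _ _) (hgs d)
  have hGz0 : ∀ t, 0 ≤ lamGz A t y z := fun t =>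
    Finset.sum_nonneg fun d _ => mul_nonneg (generalizedVonMangoldt_nonneg _ _) (hgs d)
  -- the weights `E_t`
  set E : ℕ → ℝ := fun t => ∑ p ∈ (Ioc 0 ⌊y⌋₊).filter Nat.Prime, ∑ ab ∈ range ⌊y⌋₊ ×ˢ range ⌊y⌋₊,
    Real.log p * generalizedVonMangoldt t (p ^ (ab.2 + 1)) * gsharp A (p ^ (ab.1 + ab.2 + 2)) with hE
  have hEle : ∀ t, E t ≤ K * (8 : ℝ) ^ t * t ! := fun t => hK t ⌊y⌋₊ ⌊y⌋₊
  have hE0 : ∀ t, 0 ≤ E t := fun t =>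
    Finset.sum_nonneg fun p hp => Finset.sum_nonneg fun ab _ => by
      have hpp : Nat.Prime p := (Finset.mem_filter.mp hp).2
      have : 0 ≤ Real.log p := Real.log_nonneg (by exact_mod_cast hpp.one_lt.le)
      exact mul_nonneg (mul_nonneg this (generalizedVonMangoldt_nonneg _ _)) (hgs _)
  -- the joint induction up to `j`
  have hind : ∀ i : ℕ, i ≤ j → (∀ t, t ≤ i → lamG A t y ≤ L ^ t * Θ ^ t) ∧
      lamGz A i y z ≤ i * L ^ (i - 1) * Θ ^ i * W := by
    intro i
    induction i with
    | zero =>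
      intro _
      refine ⟨fun t ht => ?_, ?_⟩
      · rw [Nat.le_zero.mp ht, lamG_zero A hy, pow_zero, pow_zero, mul_one]
      · have h0 : lamGz A 0 y z = 0 := Finset.sum_eq_zero fun d hd => by
          rw [generalizedVonMangoldt_zero_apply, if_neg (Finset.mem_filter.mp hd).2.1.ne', zero_mul]
        rw [h0]; simp
    | succ i ih =>
      intro hi1
      have hi : i ≤ j := Nat.le_of_succ_le hi1
      obtain ⟨ihG, ihGz⟩ := ih hi
      have hi16 : 16 * (i : ℝ) ≤ L := by
        have : (i : ℝ) ≤ j := by exact_mod_cast hi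
        linarith
      have herr := step_error_sum_le hK0 hL0 hΘ1 i hi16 (fun t => lamG A t y) E ihG hEle hE0
      have hGi := ihG i le_rfl
      -- `G_{i+1} ≤ L^{i+1} Θ^{i+1}`
      have hGsucc : lamG A (i + 1) y ≤ L ^ (i + 1) * Θ ^ (i + 1) := by
        have hstep := lamG_succ_le A hg0 hg1 hC₀L i hy
        have h2 : (Real.log y + C) * lamG A i y ≤ L * (L ^ i * Θ ^ i) :=
          mul_le_mul_of_nonneg_left hGi hL0.le
        calc lamG A (i + 1) y ≤ L * (L ^ i * Θ ^ i) + 2 * K * L ^ i * Θ ^ i := by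
              linarith [hstep, h2, herr]
          _ = L ^ (i + 1) * Θ ^ i * (1 + 2 * K / L) := by
              field_simp
              ring
          _ = L ^ (i + 1) * Θ ^ (i + 1) := by rw [← hΘ, pow_succ Θ i]; ring
      refine ⟨fun t ht => ?_, ?_⟩
      · rcases Nat.lt_or_ge t (i + 1) with hlt | hge
        · exact ihG t (Nat.lt_succ_iff.mp hlt)
        · rw [le_antisymm ht hge]; exact hGsucc
      · -- `G_{i+1}(z) ≤ (i+1) L^i Θ^{i+1} W`
        have hstep := lamGz_succ_le A hg0 hg1 hC₀L hC₀' i hy hz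
        have h2 : (Real.log y + C) * lamGz A i y z ≤ L * (i * L ^ (i - 1) * Θ ^ i * W) :=
          mul_le_mul_of_nonneg_left ihGz hL0.le
        have h3 : (Real.log z + C₀') * lamG A i y ≤ (Real.log z + C₀') * (L ^ i * Θ ^ i) :=
          mul_le_mul_of_nonneg_left hGi (by positivity)
        have hLpow : L * (i * L ^ (i - 1) * Θ ^ i * W) ≤ i * L ^ i * Θ ^ i * W := by
          rcases Nat.eq_zero_or_pos i with rfl | hipos
          · simp
          · have : L * L ^ (i - 1) = L ^ i := by
              rw [← pow_succ', Nat.sub_add_cancel hipos]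
            rw [show L * (i * L ^ (i - 1) * Θ ^ i * W) = i * (L * L ^ (i - 1)) * Θ ^ i * W by ring,
              this]
        have hΘsucc : Θ ^ i ≤ Θ ^ (i + 1) := pow_le_pow_right₀ hΘ1 (Nat.le_succ i)
        calc lamGz A (i + 1) y z
            ≤ L * (i * L ^ (i - 1) * Θ ^ i * W) + (Real.log z + C₀') * (L ^ i * Θ ^ i) +
                2 * K * L ^ i * Θ ^ i := by linarith [hstep, h2, h3, herr]
          _ ≤ i * L ^ i * Θ ^ i * W + (Real.log z + C₀') * (L ^ i * Θ ^ i) +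
                2 * K * L ^ i * Θ ^ i := by linarith [hLpow]
          _ = (i + 1) * L ^ i * Θ ^ i * W := by rw [hW]; ring
          _ ≤ (i + 1) * L ^ i * Θ ^ (i + 1) * W := by gcongr
          _ = ((i + 1 : ℕ) : ℝ) * L ^ (i + 1 - 1) * Θ ^ (i + 1) * W := by
              rw [Nat.add_sub_cancel]; push_cast; ring
  -- `Θ^j ≤ e^{K/8} ≤ C`
  have hΘj : Θ ^ j ≤ C := by
    have h1' : Θ ≤ Real.exp (2 * K / L) := by
      rw [hΘ]; linarith [Real.add_one_le_exp (2 * K / L)]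
    have h2' : Θ ^ j ≤ Real.exp (2 * K / L) ^ j := pow_le_pow_left₀ hΘ0.le h1' j
    have h3' : Real.exp (2 * K / L) ^ j = Real.exp (2 * K / L * j) := by
      rw [← Real.exp_nat_mul]; ring_nf
    have h4' : 2 * K / L * j ≤ K / 8 := by
      rw [div_mul_eq_mul_div, div_le_div_iff₀ hL0 (by norm_num)]
      nlinarith [hj, hK0]
    calc Θ ^ j ≤ Real.exp (2 * K / L * j) := by rw [← h3']; exact h2'
      _ ≤ Real.exp (K / 8) := Real.exp_le_exp.mpr h4'
      _ ≤ C := hC3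
  obtain ⟨hGall, hGzj⟩ := hind j le_rfl
  have hGj := hGall j le_rfl
  have hLj : 0 ≤ L ^ j := pow_nonneg hL0.le j
  constructor
  · calc lamG A j y ≤ L ^ j * Θ ^ j := hGj
      _ ≤ L ^ j * C := mul_le_mul_of_nonneg_left hΘj hLj
      _ = C * (Real.log y + C) ^ j := by rw [hL]; ring
  · have hWle : W ≤ Real.log z + C := by rw [hW]; linarith
    calc lamGz A j y z ≤ j * L ^ (j - 1) * Θ ^ j * W := hGzj
      _ ≤ j * L ^ (j - 1) * C * (Real.log z + C) := by gcongr
      _ = C * j * (Real.log y + C) ^ (j - 1) * (Real.log z + C) := by rw [hL]; ring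

end SigmaZero

end BombieriSieve

end Literature.NumberTheory.Sieve
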